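import Mathlib.Analysis.Complex.ExponentialBounds
import Mathlib.Data.Nat.Log
import Mathlib.Data.Nat.Choose.Bounds
import Literature.ModelTheory.ExponentialFields.BombieriPilaDeterminant
import HarnessLib

/-!
# The interpolation step: rational points on a `C^r` chart lie on one hypersurface of polylogarithmic degree (Binyamini–Novikov–Zak 2024, Prop. 23, `g = 1`)

Topic `Literature/ModelTheory/ExponentialFields`; a proof file in the cone of the named fact
`BinyaminiNovikovZak2024_cor_1_rat` (`WilkieConjecture.lean`), continuing
`BombieriPilaDeterminant.lean` (the one-ball step `exists_mvPolynomial_of_image_ball`).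

Source (read: arXiv:2202.05305 = Ann. of Math. 199 (2024), §6). G. Binyamini, D. Novikov,
B. Zak, *Wilkie's conjecture for Pfaffian structures*, **Proposition 23**: *"There are appropriate
choices of `r, d = poly_m(g, log H)` and `log ε = −poly_m(g, log H)` such that the following
holds. Let `φ : I^m → X` such that `φ(I^m) ⊆ X ⊂ I^{m+1}` and `‖φ‖_r ≤ 1`. Then there exists a
polynomial `P ∈ ℝ[x_1, …, x_{m+1}] ∖ {0}` of degree `d` such that `X(g, H) ⊂ {P = 0}`. Proof. …
We start with the interpolation determinant method, which directly applies to the case `g = 1`,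
i.e. to `X(ℚ, H)`. … First, for any such tuple `p` one estimates the height of `Δ^d(p)`,
concluding that either `Δ^d(p) = 0` or `|Δ^d(p)| ≥ H^{-dμ}`. On the other hand an analytic
estimate shows that for an appropriate choice of `r, d` as above we have `|Δ^d(p)| < ½H^{-dμ}`.
These contradicting estimates force `Δ^d(p) = 0` on `φ(J^m)` and finish the proof."*
(`I = (0, 1)`; `‖φ‖_r = max_{|α| ≤ r} sup |D^α φ|`, §1.2.)

This file proves the case `g = 1` (rational points) for the points of `φ(I^m)` itself (the
extension to an `ε`-neighbourhood `U_ε(φ(I^m))`, needed only for BNZ's `ε`-covers, is not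
formalised here), with the `C^r`-norm hypothesis phrased through the operator norms of the
Fréchet derivatives `‖D^i φ_l(x)‖ ≤ 1` (`i ≤ r`, sup norm on `ℝ^m`), which dominate the partial
derivatives in `‖φ‖_r`.  The explicit bookkeeping (ours; the source says "appropriate choices"):
with `n = m + 1`, `C = 6 (m+1)! · 3^{n+1} · 2^{n²}`, `s = ⌊log_3 H⌋ + 1`, `u = C s`, degree of the
pieces `d = u^m`, `a = d s`, smoothness `r = b + 1 = 2a`, `μ = binom(n + d, d)`, covering
parameter `T = 3^{n+1} 2^{n²} d²` and radius `ρ = 1/(2T)`: then `2 D_m(b) ≤ μ`, hence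
`a μ ≤ B(m, n, d)`, and `H^{dn} μ (b + 2) d^{b+1} ≤ T^a`, so the smallness condition of
`exists_mvPolynomial_of_image_ball` holds on each of the `T^m` balls of radius `ρ` covering
`I^m`; the product of the `T^m` polynomials has degree `≤ T^m d ≤ (C (log H + 1))^{2m² + 3m}`.

## Contents (all proved; no new definitions)

* `exists_norm_sub_gridCentre_le`, `gridCentre_mem_unitCube` — `I^m` is covered by the `T^m`
  sup-norm balls of radius `1/(2T)` centred at the grid points `((2j_i + 1)/(2T))_i`.
* `exists_mvPolynomial_of_image_unitCube` — the one-ball step on each ball of the grid and the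
  product of the resulting polynomials: under the smallness condition with `ρ = 1/(2T)`,
  `(φ(I^m))(ℚ, H) ⊆ {P = 0}` with `P ≠ 0`, `deg P ≤ T^m d`.
* Section `Perturbation` — the extension to points *near* the chart (BNZ, proof of Prop. 23,
  second paragraph): `abs_prod_sub_prod_le`, `abs_monomial_sub_monomial_le` (`|x^α − y^α| ≤ |α| ε`
  on the unit cube), `abs_det_sub_det_le` (`|det A − det B| ≤ μ! μ δ` for entries in `[-1, 1]`
  differing by `≤ δ`), `exists_mvPolynomial_of_near_image_ball` and
  `exists_mvPolynomial_of_near_image_unitCube` (charts with values in `[0, 1]ⁿ`, smallness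
  condition `≤ ½`, and `H^{dnμ} μ! μ d ε < ½`: all points of `[0, 1]ⁿ(ℚ, H)` within `ε` of the
  image lie on the hypersurface).
* Section `Numerics` — the parameter bookkeeping above (`partialDim_le_pow`:
  `D_m(b) ≤ (m + b)^m`; `succ_pow_le_choose_mul_factorial`: `(d + 1)^n ≤ binom(n + d, d) n!`;
  `two_mul_partialDim_le_choose`: `2 D_m(b) ≤ μ`; `mul_le_exponentB`: `a μ ≤ B`;
  `numerics_prod_le_pow`: `H^{dn} μ (2a + 1) d^{2a} ≤ T^a`; `hsmall_of_natBounds`: the smallness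
  condition of the one-ball step; `natLog_three_add_one_le`: `s ≤ log H + 1`;
  `numerics_polylog`: `r, T^m d ≤ u^{2m² + 3m}`; `choose_le_two_mul_pow`, `numerics_eps`:
  `4 H^{dnμ} μ! μ d ≤ 3^E`, `E ≤ (m + 5) u^{2m² + 3m + 2}`, the size of `1/ε`).
* `BinyaminiNovikovZak2024_prop23_rat` — **Prop. 23 for `g = 1`**: for every `m` there are
  `c, κ` such that for every `H ≥ 1` there are `r, D ≤ c (log H + 1)^κ` such that for every
  chart `φ : I^m → ℝ^{m+1}` of class `C^r` with `‖D^i φ_l‖ ≤ 1` (`i ≤ r`) on `I^m`, the set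
  `(φ(I^m))(ℚ, H)` lies in the zero set of one nonzero polynomial of degree `≤ D`
  (`…_zero`: `m = 0`; `…_pos`: `m ≥ 1`).
* `BinyaminiNovikovZak2024_prop23_rat_near` — **the same with the `ε`-neighbourhood**
  (`log(1/ε) ≤ c (log H + 1)^κ`, `ε = 1/(4 H^{dnμ} μ! μ d)`): for charts `φ : I^m → [0, 1]^{m+1}`,
  all points of `[0, 1]^{m+1}(ℚ, H)` within `ε` of `φ(I^m)` lie on the hypersurface
  (`rat_eq_of_abs_sub_lt_inv_sq`: the case `m = 0` uses that rationals with denominators `≤ H`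
  are `1/H²`-separated).
* `BinyaminiNovikovZak2024_prop23_rat_near_proj`, `BinyaminiNovikovZak2024_prop23_rat_proj` —
  charts `φ : I^m → ℝⁿ` with `n ≥ m + 1`: for each injective `J : [m+1] → [n]` a polynomial
  `P_J = P₀(x_J) ≠ 0` of degree `≤ D` in the coordinates `J` (the form used in the proof of
  BNZ Thm. 1: *"for each `J ⊂ {1, …, n}` of size `m + 1` a polynomial `P_J` … in the coordinates
  `(x_i : i ∈ J)` vanishing on `X(g, H)`"*).

## References

* G. Binyamini, D. Novikov, B. Zak, *Wilkie's conjecture for Pfaffian structures*, Ann. of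
  Math. 199 (2024) = arXiv:2202.05305, §6, Prop. 23 (with proof). [BinyaminiNovikovZak2024]
* J. Pila, *Point-Counting and the Zilber–Pink Conjecture*, CUP 2022, Lemma 9.7, Prop. 9.8 (the
  `H^ε` version of the same covering argument). [Pila2022]
* E. Bombieri, J. Pila, Duke Math. J. 59 (1989). [BombieriPila1989]
-/

noncomputable section

open Finset

namespace Literature.ModelTheory.ExponentialFields

/-! ### Covering the unit cube by small balls -/

section Cover

variable {m : ℕ}

/-- The grid centres `((j_i + ½)/T)_i` lie in the open unit cube `I^m` (`T ≥ 1`). [folklore] -/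
theorem gridCentre_mem_unitCube {T : ℕ} (hT : 1 ≤ T) (j : Fin m → Fin T) :
    (fun i => (((j i : ℕ) : ℝ) + 1 / 2) / T) ∈ Set.pi Set.univ fun _ : Fin m => Set.Ioo (0 : ℝ) 1 := by
  intro i _
  have hT' : (0 : ℝ) < T := by exact_mod_cast hT
  have hj : ((j i : ℕ) : ℝ) + 1 ≤ T := by exact_mod_cast (j i).isLt
  refine ⟨div_pos (by positivity) hT', ?_⟩
  rw [div_lt_one hT']
  linarith

/-- **`I^m` is covered by the `T^m` sup-norm balls of radius `1/(2T)` centred at the grid points**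
`((j_i + ½)/T)_i`, `j ∈ [T]^m` (take `j_i = ⌊T z_i⌋`). [folklore] -/
theorem exists_norm_sub_gridCentre_le {T : ℕ} (hT : 1 ≤ T) {z : Fin m → ℝ}
    (hz : z ∈ Set.pi Set.univ fun _ : Fin m => Set.Ioo (0 : ℝ) 1) :
    ∃ j : Fin m → Fin T, ‖z - fun i => (((j i : ℕ) : ℝ) + 1 / 2) / T‖ ≤ 1 / (2 * T) := by
  have hT' : (0 : ℝ) < T := by exact_mod_cast hT
  have hzi : ∀ i, 0 < z i ∧ z i < 1 := fun i => hz i (Set.mem_univ i)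
  have hfl : ∀ i, ⌊z i * T⌋₊ < T := fun i => by
    rw [Nat.floor_lt (by nlinarith [hzi i])]
    calc z i * T < 1 * T := by nlinarith [hzi i]
      _ = T := one_mul _
  refine ⟨fun i => ⟨⌊z i * T⌋₊, hfl i⟩, ?_⟩
  rw [pi_norm_le_iff_of_nonneg (by positivity)]
  intro i
  rw [Pi.sub_apply, Real.norm_eq_abs]
  have h1 : (⌊z i * T⌋₊ : ℝ) ≤ z i * T := Nat.floor_le (by nlinarith [hzi i])
  have h2 : z i * T < ⌊z i * T⌋₊ + 1 := Nat.lt_floor_add_one _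
  have hTi : z i - (((⌊z i * T⌋₊ : ℕ) : ℝ) + 1 / 2) / T = (z i * T - ⌊z i * T⌋₊ - 1 / 2) / T := by
    field_simp
    ring
  have hy : |z i * T - ⌊z i * T⌋₊ - 1 / 2| ≤ 1 / 2 := abs_le.mpr ⟨by linarith, by linarith⟩
  rw [show (((⟨⌊z i * T⌋₊, hfl i⟩ : Fin T) : ℕ) : ℝ) = (⌊z i * T⌋₊ : ℝ) from rfl, hTi, abs_div,
    abs_of_pos hT']
  calc |z i * T - ⌊z i * T⌋₊ - 1 / 2| / T ≤ (1 / 2) / T := div_le_div_of_nonneg_right hy hT'.le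
    _ = 1 / (2 * T) := by rw [div_div]

end Cover

/-! ### All the balls of the grid: one hypersurface for the whole chart -/

section UnitCube

variable {m n d : ℕ}

/-- **Rational points of bounded height on a chart `φ : I^m → ℝⁿ` lie on one hypersurface**, given
the smallness condition of the one-ball step at radius `ρ = 1/(2T)`: cover `I^m` by the `T^m`
balls of radius `1/(2T)` centred at the grid points (`exists_norm_sub_gridCentre_le`), apply
`exists_mvPolynomial_of_image_ball` on each, and multiply the `T^m` polynomials (degree
`≤ T^m d`; BNZ 2024, Prop. 23, proof, `g = 1`: *"These contradicting estimates force `Δ^d(p) = 0`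
on `φ(J^m)` and finish the proof"*; Pila 2022, proof of Prop. 9.8: *"cover `(0,1)^k` by
`≪ r^{-k}` discs of radius `r`"*). [cite: BinyaminiNovikovZak2024, Prop. 23 (proof)]
[cite: Pila2022, Prop. 9.8 (proof)] -/
theorem exists_mvPolynomial_of_image_unitCube {b H T : ℕ} (φ : (Fin m → ℝ) → Fin n → ℝ)
    (hφ : ∀ l, ContDiffOn ℝ (b + 1) (fun x => φ x l) (Set.pi Set.univ fun _ : Fin m => Set.Ioo (0 : ℝ) 1))
    (hφb : ∀ l, ∀ i ≤ b + 1, ∀ x ∈ Set.pi Set.univ (fun _ : Fin m => Set.Ioo (0 : ℝ) 1),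
      ‖iteratedFDeriv ℝ i (fun x => φ x l) x‖ ≤ 1)
    (hd : 1 ≤ d) (hT : 1 ≤ T)
    (hD : ∑ β ∈ Finset.range (b + 1), (m + β - 1).choose β ≤ (n + d).choose d)
    (hsmall : (H : ℝ) ^ (d * n * (n + d).choose d) *
      (((n + d).choose d).factorial * ((b + 2) ^ (n + d).choose d *
        (((d : ℝ) ^ (b + 1)) ^ (n + d).choose d *
          (1 / (2 * T) : ℝ) ^ (∑ β ∈ Finset.range (b + 1), (m + β - 1).choose β * β +
            (b + 1) * ((n + d).choose d - ∑ β ∈ Finset.range (b + 1), (m + β - 1).choose β))))) < 1) :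
    ∃ P : MvPolynomial (Fin n) ℝ, P ≠ 0 ∧ P.totalDegree ≤ T ^ m * d ∧
      ratPointsLE (φ '' Set.pi Set.univ (fun _ : Fin m => Set.Ioo (0 : ℝ) 1)) H ⊆
        {x | MvPolynomial.eval x P = 0} := by
  classical
  set U : Set (Fin m → ℝ) := Set.pi Set.univ fun _ : Fin m => Set.Ioo (0 : ℝ) 1 with hU
  have hUo : IsOpen U := isOpen_set_pi Set.finite_univ fun _ _ => isOpen_Ioo
  have hUc : Convex ℝ U := convex_pi fun _ _ => convex_Ioo 0 1
  have hT' : (0 : ℝ) < T := by exact_mod_cast hT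
  have hρ0 : (0 : ℝ) ≤ 1 / (2 * T) := by positivity
  have hρ1 : (1 / (2 * T) : ℝ) ≤ 1 := by
    rw [div_le_one (by positivity)]
    have : (1 : ℝ) ≤ T := by exact_mod_cast hT
    linarith
  -- one polynomial per ball of the grid
  have hball : ∀ j : Fin m → Fin T, ∃ P : MvPolynomial (Fin n) ℝ, P ≠ 0 ∧ P.totalDegree ≤ d ∧
      ∀ x ∈ ratPointsLE (Set.univ : Set (Fin n → ℝ)) H,
        (∃ z ∈ U, ‖z - fun i => (((j i : ℕ) : ℝ) + 1 / 2) / T‖ ≤ 1 / (2 * T) ∧ φ z = x) →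
          MvPolynomial.eval x P = 0 := fun j =>
    exists_mvPolynomial_of_image_ball hUo hUc φ hφ hφb (gridCentre_mem_unitCube hT j) hρ0 hρ1 hd
      hD hsmall
  choose P hP0 hPd hPz using hball
  refine ⟨∏ j, P j, Finset.prod_ne_zero_iff.mpr fun j _ => hP0 j, ?_, ?_⟩
  · calc (∏ j, P j).totalDegree ≤ ∑ j, (P j).totalDegree := MvPolynomial.totalDegree_finsetProd _ _
      _ ≤ ∑ _j : Fin m → Fin T, d := Finset.sum_le_sum fun j _ => hPd j
      _ = T ^ m * d := by simp [Finset.sum_const, Finset.card_univ]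
  · intro x hx
    rw [mem_ratPointsLE_iff] at hx
    obtain ⟨⟨z, hzU, hzx⟩, hxq⟩ := hx
    obtain ⟨j, hj⟩ := exists_norm_sub_gridCentre_le hT hzU
    have hxu : x ∈ ratPointsLE (Set.univ : Set (Fin n → ℝ)) H :=
      mem_ratPointsLE_iff.mpr ⟨Set.mem_univ x, hxq⟩
    have hj0 : MvPolynomial.eval x (P j) = 0 := hPz j x hxu ⟨z, hzU, hj, hzx⟩
    simp only [Set.mem_setOf_eq, map_prod]
    exact Finset.prod_eq_zero (Finset.mem_univ j) hj0

end UnitCube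

/-! ### Perturbation: points near the chart (the `ε`-neighbourhood extension) -/

section Perturbation

/-- `|∏ f − ∏ g| ≤ ∑ |f − g|` for factors bounded by `1` in absolute value. [folklore] -/
theorem abs_prod_sub_prod_le {L : Type*} [DecidableEq L] (s : Finset L) (f g : L → ℝ)
    (hf : ∀ l ∈ s, |f l| ≤ 1) (hg : ∀ l ∈ s, |g l| ≤ 1) :
    |∏ l ∈ s, f l - ∏ l ∈ s, g l| ≤ ∑ l ∈ s, |f l - g l| := by
  induction s using Finset.induction_on with
  | empty => simp
  | insert a s ha ih =>
    rw [Finset.prod_insert ha, Finset.prod_insert ha, Finset.sum_insert ha]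
    have hfa : |f a| ≤ 1 := hf a (Finset.mem_insert_self a s)
    have hgs : |∏ l ∈ s, g l| ≤ 1 := by
      rw [Finset.abs_prod]
      exact Finset.prod_le_one (fun l _ => abs_nonneg _)
        fun l hl => hg l (Finset.mem_insert_of_mem hl)
    have ih' := ih (fun l hl => hf l (Finset.mem_insert_of_mem hl))
      fun l hl => hg l (Finset.mem_insert_of_mem hl)
    have hsplit : f a * ∏ l ∈ s, f l - g a * ∏ l ∈ s, g l =
        f a * (∏ l ∈ s, f l - ∏ l ∈ s, g l) + (f a - g a) * ∏ l ∈ s, g l := by ring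
    rw [hsplit]
    calc |f a * (∏ l ∈ s, f l - ∏ l ∈ s, g l) + (f a - g a) * ∏ l ∈ s, g l|
        ≤ |f a| * |∏ l ∈ s, f l - ∏ l ∈ s, g l| + |f a - g a| * |∏ l ∈ s, g l| := by
          rw [← abs_mul, ← abs_mul]; exact abs_add_le _ _
      _ ≤ 1 * (∑ l ∈ s, |f l - g l|) + |f a - g a| * 1 := by
          gcongr
      _ = |f a - g a| + ∑ l ∈ s, |f l - g l| := by ring

/-- Monomials are `|α|`-Lipschitz on the unit cube (sup norm): for `x, y ∈ [-1, 1]^n` with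
`|x_l − y_l| ≤ ε`, `|x^α − y^α| ≤ |α| ε` (BNZ 2024, proof of Prop. 23: *"One easily estimates
`‖∂Δ^d(p)/∂p‖ ≤ dμ!` in `I^{μ×(n+1)}`"*). [folklore] -/
theorem abs_monomial_sub_monomial_le {n : ℕ} (α : Fin n → ℕ) {x y : Fin n → ℝ}
    (hx : ∀ l, |x l| ≤ 1) (hy : ∀ l, |y l| ≤ 1) {ε : ℝ} (hε : 0 ≤ ε) (hxy : ∀ l, |x l - y l| ≤ ε) :
    |∏ l, x l ^ α l - ∏ l, y l ^ α l| ≤ (∑ l, α l : ℕ) * ε := by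
  classical
  have hx1 : ∀ l, |x l ^ α l| ≤ 1 := fun l => by rw [abs_pow]; exact pow_le_one₀ (abs_nonneg _) (hx l)
  have hy1 : ∀ l, |y l ^ α l| ≤ 1 := fun l => by rw [abs_pow]; exact pow_le_one₀ (abs_nonneg _) (hy l)
  calc |∏ l, x l ^ α l - ∏ l, y l ^ α l| ≤ ∑ l, |x l ^ α l - y l ^ α l| :=
        abs_prod_sub_prod_le Finset.univ _ _ (fun l _ => hx1 l) fun l _ => hy1 l
    _ ≤ ∑ l, (α l : ℝ) * ε := Finset.sum_le_sum fun l _ => by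
        calc |x l ^ α l - y l ^ α l| ≤ |x l - y l| * α l * max |x l| |y l| ^ (α l - 1) :=
              abs_pow_sub_pow_le _ _ _
          _ ≤ ε * α l * 1 := by
              gcongr
              · exact hxy l
              · exact pow_le_one₀ (le_max_of_le_left (abs_nonneg _)) (max_le (hx l) (hy l))
          _ = (α l : ℝ) * ε := by ring
    _ = (∑ l, α l : ℕ) * ε := by push_cast; rw [Finset.sum_mul]

/-- **Perturbation of a determinant with entries in `[-1, 1]`**: if `|A_{ij}|, |B_{ij}| ≤ 1` and
`|A_{ij} − B_{ij}| ≤ δ` then `|det A − det B| ≤ μ! μ δ` (`μ` the size; multilinearity in the rows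
and the Leibniz bound `abs_det_le_factorial_mul_prod`). [folklore] -/
theorem abs_det_sub_det_le {ι : Type*} [Fintype ι] [DecidableEq ι] (A B : ι → ι → ℝ)
    (hA : ∀ i j, |A i j| ≤ 1) (hB : ∀ i j, |B i j| ≤ 1) {δ : ℝ} (hδ : 0 ≤ δ)
    (hAB : ∀ i j, |A i j - B i j| ≤ δ) :
    |(Matrix.of A).det - (Matrix.of B).det| ≤ (Fintype.card ι).factorial * Fintype.card ι * δ := by
  have hbound : ∀ M : ι → ι → ℝ, ‖(Matrix.detRowAlternating : (ι → ℝ) [⋀^ι]→ₗ[ℝ] ℝ) M‖ ≤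
      (Fintype.card ι).factorial * ∏ i, ‖M i‖ := fun M => by
    rw [Real.norm_eq_abs]
    exact abs_det_le_factorial_mul_prod (Matrix.of M) (fun j => ‖M j‖) fun j i => by
      rw [Matrix.of_apply, ← Real.norm_eq_abs]; exact norm_le_pi_norm (M j) i
  have key := AlternatingMap.norm_image_sub_le_of_bound
    (Matrix.detRowAlternating : (ι → ℝ) [⋀^ι]→ₗ[ℝ] ℝ) (by positivity) hbound A B
  have hnA : ‖A‖ ≤ 1 := (pi_norm_le_iff_of_nonneg zero_le_one).mpr fun i =>
    (pi_norm_le_iff_of_nonneg zero_le_one).mpr fun j => by rw [Real.norm_eq_abs]; exact hA i j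
  have hnB : ‖B‖ ≤ 1 := (pi_norm_le_iff_of_nonneg zero_le_one).mpr fun i =>
    (pi_norm_le_iff_of_nonneg zero_le_one).mpr fun j => by rw [Real.norm_eq_abs]; exact hB i j
  have hnAB : ‖A - B‖ ≤ δ := (pi_norm_le_iff_of_nonneg hδ).mpr fun i =>
    (pi_norm_le_iff_of_nonneg hδ).mpr fun j => by rw [Real.norm_eq_abs]; exact hAB i j
  have hmax : max ‖A‖ ‖B‖ ^ (Fintype.card ι - 1) ≤ 1 :=
    pow_le_one₀ (le_max_of_le_left (norm_nonneg _)) (max_le hnA hnB)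
  rw [← Real.norm_eq_abs]
  calc ‖(Matrix.of A).det - (Matrix.of B).det‖ = ‖(Matrix.detRowAlternating : (ι → ℝ) [⋀^ι]→ₗ[ℝ] ℝ) A -
        (Matrix.detRowAlternating : (ι → ℝ) [⋀^ι]→ₗ[ℝ] ℝ) B‖ := rfl
    _ ≤ (Fintype.card ι).factorial * Fintype.card ι * max ‖A‖ ‖B‖ ^ (Fintype.card ι - 1) *
        ‖A - B‖ := key
    _ ≤ (Fintype.card ι).factorial * Fintype.card ι * 1 * δ := by gcongr
    _ = (Fintype.card ι).factorial * Fintype.card ι * δ := by ring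

variable {m n d : ℕ}

/-- **Rational points of bounded height near the image of a small ball lie on one hypersurface**
(BNZ 2024, proof of Prop. 23, the extension to `U_ε(φ(J^m))`: *"Let `q_1, …, q_μ ∈ φ(J^m)` with
`dist(p_i, q_i) ≤ ε`. Then `Δ^d(q) < ½H^{-dμ}` as above, and if show `|Δ^d(q) − Δ^d(p)| < ½H^{-dμ}`
we can finish as above. One easily estimates `‖∂Δ^d(p)/∂p‖ ≤ dμ!` in `I^{μ×(n+1)}`, so choosing
`ε ∼ ½H^{-dμ}/[d(μ+2)!]` suffices"*). As `exists_mvPolynomial_of_image_ball`, for a chart with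
values in `[0, 1]ⁿ`, the smallness condition now `≤ ½`, and points `x ∈ [0,1]ⁿ(ℚ, H)` with
`‖φ(z) − x‖ ≤ ε` for some `z` in the ball, where `H^{dnμ} μ! μ d ε < ½`
(`abs_det_sub_det_le`, `abs_monomial_sub_monomial_le`).
[cite: BinyaminiNovikovZak2024, Prop. 23 (proof)] -/
theorem exists_mvPolynomial_of_near_image_ball {b H : ℕ} {U : Set (Fin m → ℝ)} (hU : IsOpen U)
    (hUc : Convex ℝ U) (φ : (Fin m → ℝ) → Fin n → ℝ)
    (hφ : ∀ l, ContDiffOn ℝ (b + 1) (fun x => φ x l) U)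
    (hφb : ∀ l, ∀ i ≤ b + 1, ∀ x ∈ U, ‖iteratedFDeriv ℝ i (fun x => φ x l) x‖ ≤ 1)
    (hφI : Set.MapsTo φ U (Set.pi Set.univ fun _ : Fin n => Set.Icc (0 : ℝ) 1))
    {z₀ : Fin m → ℝ} (hz₀ : z₀ ∈ U) {ρ : ℝ} (hρ0 : 0 ≤ ρ) (hρ1 : ρ ≤ 1) (hd : 1 ≤ d)
    (hD : ∑ β ∈ Finset.range (b + 1), (m + β - 1).choose β ≤ (n + d).choose d) {ε : ℝ}
    (hε0 : 0 ≤ ε)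
    (hsmall : (H : ℝ) ^ (d * n * (n + d).choose d) *
      (((n + d).choose d).factorial * ((b + 2) ^ (n + d).choose d *
        (((d : ℝ) ^ (b + 1)) ^ (n + d).choose d *
          ρ ^ (∑ β ∈ Finset.range (b + 1), (m + β - 1).choose β * β +
            (b + 1) * ((n + d).choose d - ∑ β ∈ Finset.range (b + 1), (m + β - 1).choose β))))) ≤
      1 / 2)
    (hε : (H : ℝ) ^ (d * n * (n + d).choose d) *
      (((n + d).choose d).factorial * ((n + d).choose d * (d * ε))) < 1 / 2) :
    ∃ P : MvPolynomial (Fin n) ℝ, P ≠ 0 ∧ P.totalDegree ≤ d ∧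
      ∀ x ∈ ratPointsLE (Set.pi Set.univ fun _ : Fin n => Set.Icc (0 : ℝ) 1) H,
        (∃ z ∈ U, ‖z - z₀‖ ≤ ρ ∧ ‖φ z - x‖ ≤ ε) → MvPolynomial.eval x P = 0 := by
  classical
  set ex : Sym (Fin (n + 1)) d → (Fin n →₀ ℕ) := fun s =>
    Finsupp.equivFunOnFinite.symm fun l : Fin n => (s : Multiset (Fin (n + 1))).count l.castSucc
    with hex
  set S : Set (Fin n → ℝ) := {x | x ∈ ratPointsLE (Set.pi Set.univ fun _ : Fin n =>
    Set.Icc (0 : ℝ) 1) H ∧ ∃ z ∈ U, ‖z - z₀‖ ≤ ρ ∧ ‖φ z - x‖ ≤ ε} with hS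
  have hSsub : S ⊆ ratPointsLE (Set.pi Set.univ fun _ : Fin n => Set.Icc (0 : ℝ) 1) H :=
    fun x hx => hx.1
  have hcard : Fintype.card (Sym (Fin (n + 1)) d) = (n + d).choose d := card_sym_fin_succ
  suffices key : ∀ e : Sym (Fin (n + 1)) d → Fin n → ℝ, (∀ i, e i ∈ S) →
      (H : ℝ) ^ (d * Fintype.card (Fin n) * Fintype.card (Sym (Fin (n + 1)) d)) *
        |(Matrix.of fun i j => ∏ l, e i l ^ ex j l).det| < 1 by
    obtain ⟨P, hP0, hPd, hPS⟩ :=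
      exists_mvPolynomial_of_abs_det_lt ex injective_symExponent degree_symExponent_le hSsub key
    exact ⟨P, hP0, hPd, fun x hx hz => hPS x ⟨hx, hz⟩⟩
  intro e he
  choose z hzU hzρ hze using fun i => (he i).2
  have heI : ∀ i l, e i l ∈ Set.Icc (0 : ℝ) 1 := fun i l =>
    (ratPointsLE_subset _ _ (he i).1) l (Set.mem_univ l)
  have hφzI : ∀ i l, φ (z i) l ∈ Set.Icc (0 : ℝ) 1 := fun i l => hφI (hzU i) l (Set.mem_univ l)
  -- the monomials in the chart coordinates and the two matrices
  set ψ : Sym (Fin (n + 1)) d → (Fin m → ℝ) → ℝ := fun j x => ∏ l, φ x l ^ ex j l with hψ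
  set A : Matrix (Sym (Fin (n + 1)) d) (Sym (Fin (n + 1)) d) ℝ :=
    Matrix.of fun i j => ∏ l, e i l ^ ex j l with hA
  set Bm : Matrix (Sym (Fin (n + 1)) d) (Sym (Fin (n + 1)) d) ℝ :=
    Matrix.of fun i j => ψ j (z i) with hBm
  -- the analytic estimate for `Bm`
  have hψc : ∀ j, ContDiffOn ℝ (b + 1) (ψ j) U := fun j =>
    contDiffOn_prod fun l _ => (hφ l).pow _
  have hdeg : ∀ j, ((∑ l ∈ Finset.univ, ex j l : ℕ) : ℝ) ≤ d := fun j => by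
    have h := degree_symExponent_le (n := n) (d := d) j
    rw [Finsupp.degree_eq_sum] at h
    exact_mod_cast h
  have hM : ∀ j, ∀ β ≤ b + 1, ∀ x ∈ U, ‖iteratedFDeriv ℝ β (ψ j) x‖ ≤ (d : ℝ) ^ (b + 1) := by
    intro j β hβ x hx
    have h := norm_iteratedFDeriv_prod_pow_le hU Finset.univ (fun l x => φ x l) (n := b + 1)
      (fun l _ => hφ l) hx (fun l _ i hi => hφb l i hi x hx) (fun l => ex j l) β hβ
    refine h.trans ?_
    calc ((∑ l ∈ Finset.univ, ex j l : ℕ) : ℝ) ^ β ≤ (d : ℝ) ^ β :=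
          pow_le_pow_left₀ (by positivity) (hdeg j) β
      _ ≤ (d : ℝ) ^ (b + 1) := pow_le_pow_right₀ (by exact_mod_cast hd) hβ
  have hDcard : ∑ β ∈ Finset.range (b + 1), (m + β - 1).choose β ≤
      Fintype.card (Sym (Fin (n + 1)) d) := hcard ▸ hD
  have hdet := abs_det_le_of_contDiffOn hU hUc ψ hψc hz₀ z hzU hρ0 hρ1 hzρ (by positivity) hM
    hDcard
  rw [hcard] at hdet
  -- the perturbation estimate for `A − Bm`
  have hA1 : ∀ i j, |A i j| ≤ 1 := fun i j => by
    simp only [hA, Matrix.of_apply, Finset.abs_prod, abs_pow]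
    exact Finset.prod_le_one (fun l _ => by positivity) fun l _ =>
      pow_le_one₀ (abs_nonneg _) (abs_le.mpr ⟨by linarith [(heI i l).1], (heI i l).2⟩)
  have hB1 : ∀ i j, |Bm i j| ≤ 1 := fun i j => by
    simp only [hBm, hψ, Matrix.of_apply, Finset.abs_prod, abs_pow]
    exact Finset.prod_le_one (fun l _ => by positivity) fun l _ =>
      pow_le_one₀ (abs_nonneg _) (abs_le.mpr ⟨by linarith [(hφzI i l).1], (hφzI i l).2⟩)
  have hAB : ∀ i j, |A i j - Bm i j| ≤ d * ε := fun i j => by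
    simp only [hA, hBm, hψ, Matrix.of_apply]
    have h := abs_monomial_sub_monomial_le (fun l => ex j l)
      (fun l => abs_le.mpr ⟨by linarith [(heI i l).1], (heI i l).2⟩)
      (fun l => abs_le.mpr ⟨by linarith [(hφzI i l).1], (hφzI i l).2⟩) hε0
      (fun l => by
        rw [abs_sub_comm, ← Real.norm_eq_abs]
        exact (norm_le_pi_norm (φ (z i) - e i) l).trans (hze i))
    refine h.trans (mul_le_mul_of_nonneg_right ?_ hε0)
    exact_mod_cast hdeg j
  have hdiff : |A.det - Bm.det| ≤
      ((n + d).choose d).factorial * ((n + d).choose d) * (d * ε) := by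
    have h := abs_det_sub_det_le (fun i j => ∏ l, e i l ^ ex j l) (fun i j => ψ j (z i))
      hA1 hB1 (by positivity) hAB
    rwa [hcard] at h
  have habs : |A.det| ≤ |Bm.det| + |A.det - Bm.det| := by
    linarith [abs_sub_abs_le_abs_sub A.det Bm.det]
  rw [Fintype.card_fin, hcard]
  calc (H : ℝ) ^ (d * n * (n + d).choose d) * |A.det|
      ≤ (H : ℝ) ^ (d * n * (n + d).choose d) * (|Bm.det| + |A.det - Bm.det|) :=
        mul_le_mul_of_nonneg_left habs (by positivity)
    _ ≤ (H : ℝ) ^ (d * n * (n + d).choose d) *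
        (((n + d).choose d).factorial * ((b + 2) ^ (n + d).choose d *
          (((d : ℝ) ^ (b + 1)) ^ (n + d).choose d *
            ρ ^ (∑ β ∈ Finset.range (b + 1), (m + β - 1).choose β * β +
              (b + 1) * ((n + d).choose d - ∑ β ∈ Finset.range (b + 1),
                (m + β - 1).choose β))))) +
        (H : ℝ) ^ (d * n * (n + d).choose d) *
          (((n + d).choose d).factorial * ((n + d).choose d * (d * ε))) := by
        rw [mul_add]
        exact add_le_add (mul_le_mul_of_nonneg_left hdet (by positivity))
          (mul_le_mul_of_nonneg_left (hdiff.trans_eq (by ring)) (by positivity))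
    _ < 1 / 2 + 1 / 2 := add_lt_add_of_le_of_lt hsmall hε
    _ = 1 := by norm_num

/-- **The `ε`-neighbourhood version on the whole chart**: as
`exists_mvPolynomial_of_image_unitCube`, for a chart `φ : I^m → [0, 1]ⁿ`, with the conclusion
for all points of `[0, 1]ⁿ(ℚ, H)` within `ε` of `φ(I^m)` (BNZ 2024, Prop. 23 with
`X(g, H) ∩ U_ε(φ(I^m))`, `g = 1`). [cite: BinyaminiNovikovZak2024, Prop. 23 (proof)] -/
theorem exists_mvPolynomial_of_near_image_unitCube {b H T : ℕ} (φ : (Fin m → ℝ) → Fin n → ℝ)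
    (hφ : ∀ l, ContDiffOn ℝ (b + 1) (fun x => φ x l) (Set.pi Set.univ fun _ : Fin m => Set.Ioo (0 : ℝ) 1))
    (hφb : ∀ l, ∀ i ≤ b + 1, ∀ x ∈ Set.pi Set.univ (fun _ : Fin m => Set.Ioo (0 : ℝ) 1),
      ‖iteratedFDeriv ℝ i (fun x => φ x l) x‖ ≤ 1)
    (hφI : Set.MapsTo φ (Set.pi Set.univ fun _ : Fin m => Set.Ioo (0 : ℝ) 1)
      (Set.pi Set.univ fun _ : Fin n => Set.Icc (0 : ℝ) 1))
    (hd : 1 ≤ d) (hT : 1 ≤ T)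
    (hD : ∑ β ∈ Finset.range (b + 1), (m + β - 1).choose β ≤ (n + d).choose d) {ε : ℝ}
    (hε0 : 0 ≤ ε)
    (hsmall : (H : ℝ) ^ (d * n * (n + d).choose d) *
      (((n + d).choose d).factorial * ((b + 2) ^ (n + d).choose d *
        (((d : ℝ) ^ (b + 1)) ^ (n + d).choose d *
          (1 / (2 * T) : ℝ) ^ (∑ β ∈ Finset.range (b + 1), (m + β - 1).choose β * β +
            (b + 1) * ((n + d).choose d - ∑ β ∈ Finset.range (b + 1), (m + β - 1).choose β))))) ≤
      1 / 2)
    (hε : (H : ℝ) ^ (d * n * (n + d).choose d) *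
      (((n + d).choose d).factorial * ((n + d).choose d * (d * ε))) < 1 / 2) :
    ∃ P : MvPolynomial (Fin n) ℝ, P ≠ 0 ∧ P.totalDegree ≤ T ^ m * d ∧
      ∀ x ∈ ratPointsLE (Set.pi Set.univ fun _ : Fin n => Set.Icc (0 : ℝ) 1) H,
        (∃ z ∈ Set.pi Set.univ (fun _ : Fin m => Set.Ioo (0 : ℝ) 1), ‖φ z - x‖ ≤ ε) →
          MvPolynomial.eval x P = 0 := by
  classical
  set U : Set (Fin m → ℝ) := Set.pi Set.univ fun _ : Fin m => Set.Ioo (0 : ℝ) 1 with hU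
  have hUo : IsOpen U := isOpen_set_pi Set.finite_univ fun _ _ => isOpen_Ioo
  have hUc : Convex ℝ U := convex_pi fun _ _ => convex_Ioo 0 1
  have hT' : (0 : ℝ) < T := by exact_mod_cast hT
  have hρ0 : (0 : ℝ) ≤ 1 / (2 * T) := by positivity
  have hρ1 : (1 / (2 * T) : ℝ) ≤ 1 := by
    rw [div_le_one (by positivity)]
    have : (1 : ℝ) ≤ T := by exact_mod_cast hT
    linarith
  have hball : ∀ j : Fin m → Fin T, ∃ P : MvPolynomial (Fin n) ℝ, P ≠ 0 ∧ P.totalDegree ≤ d ∧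
      ∀ x ∈ ratPointsLE (Set.pi Set.univ fun _ : Fin n => Set.Icc (0 : ℝ) 1) H,
        (∃ z ∈ U, ‖z - fun i => (((j i : ℕ) : ℝ) + 1 / 2) / T‖ ≤ 1 / (2 * T) ∧ ‖φ z - x‖ ≤ ε) →
          MvPolynomial.eval x P = 0 := fun j =>
    exists_mvPolynomial_of_near_image_ball hUo hUc φ hφ hφb hφI (gridCentre_mem_unitCube hT j)
      hρ0 hρ1 hd hD hε0 hsmall hε
  choose P hP0 hPd hPz using hball
  refine ⟨∏ j, P j, Finset.prod_ne_zero_iff.mpr fun j _ => hP0 j, ?_, ?_⟩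
  · calc (∏ j, P j).totalDegree ≤ ∑ j, (P j).totalDegree := MvPolynomial.totalDegree_finsetProd _ _
      _ ≤ ∑ _j : Fin m → Fin T, d := Finset.sum_le_sum fun j _ => hPd j
      _ = T ^ m * d := by simp [Finset.sum_const, Finset.card_univ]
  · intro x hx ⟨z, hzU, hzx⟩
    obtain ⟨j, hj⟩ := exists_norm_sub_gridCentre_le hT hzU
    have hj0 : MvPolynomial.eval x (P j) = 0 := hPz j x hx ⟨z, hzU, hj, hzx⟩
    simp only [map_prod]
    exact Finset.prod_eq_zero (Finset.mem_univ j) hj0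

end Perturbation

/-! ### Parameter bookkeeping -/

section Numerics

/-- `D_m(b) = ∑_{β ≤ b} binom(m + β − 1, β) ≤ (m + b)^m` for `m ≥ 1`: each of the `b + 1 ≤ m + b`
terms is `binom(β + m − 1, m − 1) ≤ (m + b)^{m−1}`. [folklore] -/
theorem partialDim_le_pow {m : ℕ} (hm : 1 ≤ m) (b : ℕ) :
    ∑ β ∈ Finset.range (b + 1), (m + β - 1).choose β ≤ (m + b) ^ m := by
  calc ∑ β ∈ Finset.range (b + 1), (m + β - 1).choose β
      ≤ ∑ _β ∈ Finset.range (b + 1), (m + b) ^ (m - 1) := Finset.sum_le_sum fun β hβ => by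
        have hβb : β ≤ b := Nat.lt_succ_iff.mp (Finset.mem_range.mp hβ)
        have h1 : m + β - 1 = β + (m - 1) := by omega
        rw [h1, Nat.choose_symm_add]
        exact (Nat.choose_le_pow _ _).trans (Nat.pow_le_pow_left (by omega) _)
    _ = (b + 1) * (m + b) ^ (m - 1) := by rw [Finset.sum_const, Finset.card_range, smul_eq_mul]
    _ ≤ (m + b) * (m + b) ^ (m - 1) := Nat.mul_le_mul_right _ (by omega)
    _ = (m + b) ^ m := by rw [← pow_succ']; congr 1; omega

/-- `(d + 1)^n ≤ binom(n + d, d) · n!` (from `d! (d + 1)^n ≤ (d + n)!`). [folklore] -/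
theorem succ_pow_le_choose_mul_factorial (n d : ℕ) : (d + 1) ^ n ≤ (n + d).choose d * n.factorial := by
  have h := Nat.factorial_mul_pow_le_factorial (m := d) (n := n)
  have h2 : (d + n).choose d * d.factorial * n.factorial = (d + n).factorial := by
    have := Nat.choose_mul_factorial_mul_factorial (n := d + n) (k := d) (Nat.le_add_right d n)
    rwa [Nat.add_sub_cancel_left] at this
  rw [Nat.add_comm n d]
  refine Nat.le_of_mul_le_mul_left ?_ (Nat.factorial_pos d)
  calc d.factorial * (d + 1) ^ n ≤ (d + n).factorial := h
    _ = d.factorial * ((d + n).choose d * n.factorial) := by rw [← h2]; ring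

variable {m s C d a b : ℕ}

/-- With `C ≥ 6 (m+1)!`, `d = (Cs)^m`, `a = ds`, `b + 1 = 2a` (`m, s ≥ 1`): `2 D_m(b) ≤ μ = binom(m+1+d, d)`
(`2 D_m(b) (m+1)! ≤ 2 (3a)^m (m+1)! ≤ C^m d^m s^m = d^{m+1} ≤ μ (m+1)!`). [folklore] -/
theorem two_mul_partialDim_le_choose (hm : 1 ≤ m) (hs : 1 ≤ s) (hC : 6 * (m + 1).factorial ≤ C)
    (hd : d = (C * s) ^ m) (ha : a = d * s) (hb : b + 1 = 2 * a) :
    2 * ∑ β ∈ Finset.range (b + 1), (m + β - 1).choose β ≤ (m + 1 + d).choose d := by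
  have hCm : 2 * 3 ^ m * (m + 1).factorial ≤ C ^ m := by
    calc 2 * 3 ^ m * (m + 1).factorial ≤ 2 ^ m * 3 ^ m * (m + 1).factorial ^ m :=
          Nat.mul_le_mul (Nat.mul_le_mul_right _ (Nat.le_self_pow (by omega) 2))
            (Nat.le_self_pow (by omega) _)
      _ = (6 * (m + 1).factorial) ^ m := by
          rw [mul_pow, show (6 : ℕ) = 2 * 3 from rfl, mul_pow]
      _ ≤ C ^ m := Nat.pow_le_pow_left hC m
  have hC1 : m + 1 ≤ C :=
    le_trans (le_trans (Nat.self_le_factorial (m + 1)) (Nat.le_mul_of_pos_left _ (by norm_num))) hC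
  have hu : m + 1 ≤ C * s := le_trans hC1 (Nat.le_mul_of_pos_right _ hs)
  have hdu : C * s ≤ d := hd ▸ Nat.le_self_pow (by omega) _
  have hda : d ≤ a := ha ▸ Nat.le_mul_of_pos_right _ hs
  have h3a : m + b ≤ 3 * a := by omega
  have key : 2 * (m + b) ^ m * (m + 1).factorial ≤ (m + 1 + d).choose d * (m + 1).factorial := by
    calc 2 * (m + b) ^ m * (m + 1).factorial ≤ 2 * (3 * a) ^ m * (m + 1).factorial := by gcongr
      _ = 2 * 3 ^ m * (m + 1).factorial * (d ^ m * s ^ m) := by rw [ha]; ring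
      _ ≤ C ^ m * (d ^ m * s ^ m) := Nat.mul_le_mul_right _ hCm
      _ = d ^ (m + 1) := by rw [hd]; ring
      _ ≤ (d + 1) ^ (m + 1) := Nat.pow_le_pow_left (Nat.le_succ d) _
      _ ≤ (m + 1 + d).choose d * (m + 1).factorial := succ_pow_le_choose_mul_factorial (m + 1) d
  have hle := Nat.le_of_mul_le_mul_right key (Nat.factorial_pos _)
  exact le_trans (Nat.mul_le_mul_left 2 (partialDim_le_pow hm b)) hle

/-- `a μ ≤ B = ∑ (…) + (b + 1)(μ − D)` once `b + 1 = 2a` and `2D ≤ μ`. [folklore] -/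
theorem mul_le_exponentB {μ D S : ℕ} (hb : b + 1 = 2 * a) (h2 : 2 * D ≤ μ) :
    a * μ ≤ S + (b + 1) * (μ - D) := by
  have h3 : μ ≤ 2 * (μ - D) := by omega
  calc a * μ ≤ a * (2 * (μ - D)) := Nat.mul_le_mul_left a h3
    _ = (b + 1) * (μ - D) := by rw [hb]; ring
    _ ≤ S + (b + 1) * (μ - D) := Nat.le_add_left _ _

/-- The product estimate: with `C ≥ 6 (m+1)!`, `d = (Cs)^m`, `a = ds`, `H ≤ 3^s`,
`H^{d(m+1)} · μ · (2a + 1) · d^{2a} ≤ (3^{m+2} 2^{(m+1)²} d²)^a` (`H^{d(m+1)} ≤ (3^{m+1})^a`,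
`μ ≤ (2d)^{m+1} ≤ (2^{(m+1)²})^a` using `Cs ≤ 2^{Cs}` and `Cs ≤ a`, `2a + 1 ≤ 3^a`). [folklore] -/
theorem numerics_prod_le_pow (hm : 1 ≤ m) (hs : 1 ≤ s) (hC : 6 * (m + 1).factorial ≤ C)
    (hd : d = (C * s) ^ m) (ha : a = d * s) {H : ℕ} (hH : H ≤ 3 ^ s) :
    H ^ (d * (m + 1)) * ((m + 1 + d).choose d * ((2 * a + 1) * d ^ (2 * a))) ≤
      (3 ^ (m + 2) * 2 ^ ((m + 1) * (m + 1)) * d ^ 2) ^ a := by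
  have hC1 : m + 1 ≤ C :=
    le_trans (le_trans (Nat.self_le_factorial (m + 1)) (Nat.le_mul_of_pos_left _ (by norm_num))) hC
  have hu : m + 1 ≤ C * s := le_trans hC1 (Nat.le_mul_of_pos_right _ hs)
  have hdu : C * s ≤ d := hd ▸ Nat.le_self_pow (by omega) _
  have hda : d ≤ a := ha ▸ Nat.le_mul_of_pos_right _ hs
  have hta : C * s ≤ a := hdu.trans hda
  have p1 : H ^ (d * (m + 1)) ≤ (3 ^ (m + 1)) ^ a :=
    calc H ^ (d * (m + 1)) ≤ (3 ^ s) ^ (d * (m + 1)) := Nat.pow_le_pow_left hH _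
      _ = (3 ^ (m + 1)) ^ a := by rw [ha, ← pow_mul, ← pow_mul]; congr 1; ring
  have p2a : d ^ (m + 1) ≤ 2 ^ (a * (m * (m + 1))) :=
    calc d ^ (m + 1) = (C * s) ^ (m * (m + 1)) := by rw [hd, ← pow_mul]
      _ ≤ (2 ^ (C * s)) ^ (m * (m + 1)) := Nat.pow_le_pow_left (Nat.lt_two_pow_self).le _
      _ = 2 ^ ((C * s) * (m * (m + 1))) := by rw [← pow_mul]
      _ ≤ 2 ^ (a * (m * (m + 1))) := Nat.pow_le_pow_right (by norm_num) (Nat.mul_le_mul_right _ hta)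
  have p2 : (m + 1 + d).choose d ≤ (2 ^ ((m + 1) * (m + 1))) ^ a :=
    calc (m + 1 + d).choose d = (m + 1 + d).choose (m + 1) := by rw [← Nat.choose_symm_add]
      _ ≤ (m + 1 + d) ^ (m + 1) := Nat.choose_le_pow _ _
      _ ≤ (2 * d) ^ (m + 1) := Nat.pow_le_pow_left (by omega) _
      _ = 2 ^ (m + 1) * d ^ (m + 1) := mul_pow _ _ _
      _ ≤ 2 ^ (a * (m + 1)) * 2 ^ (a * (m * (m + 1))) :=
          Nat.mul_le_mul (Nat.pow_le_pow_right (by norm_num) (by nlinarith)) p2a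
      _ = (2 ^ ((m + 1) * (m + 1))) ^ a := by rw [← pow_add, ← pow_mul]; congr 1; ring
  have p3 : 2 * a + 1 ≤ 3 ^ a := by
    -- `2k + 1 ≤ 3^k` (also `Literature.Probability.LatticeModels.two_mul_add_one_le_three_pow`)
    clear * -
    induction a with
    | zero => norm_num
    | succ k ih => rw [pow_succ]; omega
  have p4 : d ^ (2 * a) = (d ^ 2) ^ a := by rw [← pow_mul]
  calc H ^ (d * (m + 1)) * ((m + 1 + d).choose d * ((2 * a + 1) * d ^ (2 * a)))
      ≤ (3 ^ (m + 1)) ^ a * ((2 ^ ((m + 1) * (m + 1))) ^ a * (3 ^ a * (d ^ 2) ^ a)) := by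
        rw [p4]; exact Nat.mul_le_mul p1 (Nat.mul_le_mul p2 (Nat.mul_le_mul_right _ p3))
    _ = (3 ^ (m + 2) * 2 ^ ((m + 1) * (m + 1)) * d ^ 2) ^ a := by
        rw [mul_pow, mul_pow, pow_succ 3 (m + 1), mul_pow]; ring

/-- The smallness condition of the one-ball step at radius `ρ = 1/(2T)` from the natural-number
bookkeeping: if `b + 1 = 2a`, `a μ ≤ B`, and `H^{dn} μ (2a + 1) d^{2a} ≤ T^a`, then
`H^{dnμ} μ! (b + 2)^μ d^{(b+1)μ} ρ^B ≤ (H^{dn} μ (2a+1) d^{2a} ρ^a)^μ ≤ ((Tρ)^a)^μ = 2^{-aμ} ≤ ½`.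
[folklore] -/
theorem hsmall_of_natBounds {μ n H T B : ℕ} (hμ : 1 ≤ μ) (ha1 : 1 ≤ a) (hb : b + 1 = 2 * a)
    (haB : a * μ ≤ B) (hT : 1 ≤ T)
    (hprod : H ^ (d * n) * (μ * ((2 * a + 1) * d ^ (2 * a))) ≤ T ^ a) :
    (H : ℝ) ^ (d * n * μ) * ((μ.factorial : ℕ) * ((b + 2) ^ μ *
      (((d : ℝ) ^ (b + 1)) ^ μ * (1 / (2 * T) : ℝ) ^ B))) ≤ 1 / 2 := by
  set ρ : ℝ := 1 / (2 * T) with hρ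
  have hT' : (0 : ℝ) < T := by exact_mod_cast hT
  have hρ0 : 0 ≤ ρ := by positivity
  have hρ1 : ρ ≤ 1 := by
    rw [hρ, div_le_one (by positivity)]
    have : (1 : ℝ) ≤ T := by exact_mod_cast hT
    linarith
  have hTρ : (T : ℝ) * ρ = 1 / 2 := by rw [hρ]; field_simp
  have hb2 : (b : ℝ) + 2 = ((2 * a + 1 : ℕ) : ℝ) := by
    have : ((b + 1 : ℕ) : ℝ) = ((2 * a : ℕ) : ℝ) := by rw [hb]
    push_cast at this ⊢
    linarith
  have e1 : ((μ.factorial : ℕ) : ℝ) ≤ ((μ ^ μ : ℕ) : ℝ) := by exact_mod_cast Nat.factorial_le_pow μ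
  have e2 : ρ ^ B ≤ (ρ ^ a) ^ μ := by rw [← pow_mul]; exact pow_le_pow_of_le_one hρ0 hρ1 haB
  have step : (H : ℝ) ^ (d * n * μ) * ((μ.factorial : ℕ) * (((b : ℝ) + 2) ^ μ *
      (((d : ℝ) ^ (b + 1)) ^ μ * ρ ^ B))) ≤
      ((((H ^ (d * n) * (μ * ((2 * a + 1) * d ^ (2 * a))) : ℕ) : ℝ)) * ρ ^ a) ^ μ := by
    calc (H : ℝ) ^ (d * n * μ) * ((μ.factorial : ℕ) * (((b : ℝ) + 2) ^ μ *
          (((d : ℝ) ^ (b + 1)) ^ μ * ρ ^ B)))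
        ≤ (H : ℝ) ^ (d * n * μ) * (((μ ^ μ : ℕ) : ℝ) * (((b : ℝ) + 2) ^ μ *
          (((d : ℝ) ^ (b + 1)) ^ μ * (ρ ^ a) ^ μ))) := by gcongr
      _ = ((((H ^ (d * n) * (μ * ((2 * a + 1) * d ^ (2 * a))) : ℕ) : ℝ)) * ρ ^ a) ^ μ := by
          rw [hb2, hb]
          simp only [Nat.cast_mul, Nat.cast_pow]
          ring
  have hN : ((H ^ (d * n) * (μ * ((2 * a + 1) * d ^ (2 * a))) : ℕ) : ℝ) * ρ ^ a ≤ 1 / 2 := by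
    calc ((H ^ (d * n) * (μ * ((2 * a + 1) * d ^ (2 * a))) : ℕ) : ℝ) * ρ ^ a
        ≤ ((T ^ a : ℕ) : ℝ) * ρ ^ a := by gcongr
      _ = ((T : ℝ) * ρ) ^ a := by rw [mul_pow]; norm_cast
      _ = (1 / 2) ^ a := by rw [hTρ]
      _ ≤ 1 / 2 := pow_le_of_le_one (by norm_num) (by norm_num) (by omega)
  exact step.trans ((pow_le_of_le_one (by positivity) (hN.trans (by norm_num)) (by omega)).trans hN)

/-- `⌊log_3 H⌋ + 1 ≤ log H + 1` for `H ≥ 1` (as `log 3 ≥ 1`). [folklore] -/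
theorem natLog_three_add_one_le {H : ℕ} (hH : 1 ≤ H) :
    ((Nat.log 3 H + 1 : ℕ) : ℝ) ≤ Real.log H + 1 := by
  have h3 : (3 : ℝ) ^ Nat.log 3 H ≤ H := by exact_mod_cast Nat.pow_log_le_self 3 (by omega : H ≠ 0)
  have hlog3 : (1 : ℝ) ≤ Real.log 3 := by
    rw [← Real.log_exp 1]
    exact Real.log_le_log (Real.exp_pos 1) Real.exp_one_lt_three.le
  have hk : (Nat.log 3 H : ℝ) * Real.log 3 ≤ Real.log H := by
    rw [← Real.log_pow]
    exact Real.log_le_log (by positivity) h3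
  have hk' : (Nat.log 3 H : ℝ) ≤ Real.log H := by
    nlinarith [hk, hlog3, (Nat.cast_nonneg (Nat.log 3 H) : (0 : ℝ) ≤ _)]
  push_cast
  linarith

/-- The polylogarithmic size of the parameters: with `u = Cs ≥ 2`, `s ≤ u`, `3^{m+2} ≤ u`,
`2^{(m+1)²} ≤ u`, `d = u^m`, `a = ds` (`m ≥ 1`): `2a ≤ u^{2m² + 3m}` and `T^m d ≤ u^{2m² + 3m}` for
`T = 3^{m+2} 2^{(m+1)²} d²`. [folklore] -/
theorem numerics_polylog {u : ℕ} (hm : 1 ≤ m) (h2 : 2 ≤ u) (hsu : s ≤ u) (h3 : 3 ^ (m + 2) ≤ u)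
    (h4 : 2 ^ ((m + 1) * (m + 1)) ≤ u) (hd : d = u ^ m) (ha : a = d * s) :
    2 * a ≤ u ^ (2 * m * m + 3 * m) ∧
      (3 ^ (m + 2) * 2 ^ ((m + 1) * (m + 1)) * d ^ 2) ^ m * d ≤ u ^ (2 * m * m + 3 * m) := by
  have hu1 : 1 ≤ u := by omega
  constructor
  · calc 2 * a = 2 * u ^ m * s := by rw [ha, hd]; ring
      _ ≤ u * u ^ m * u := Nat.mul_le_mul (Nat.mul_le_mul_right _ h2) hsu
      _ = u ^ (m + 2) := by ring
      _ ≤ u ^ (2 * m * m + 3 * m) := Nat.pow_le_pow_right hu1 (by nlinarith)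
  · calc (3 ^ (m + 2) * 2 ^ ((m + 1) * (m + 1)) * d ^ 2) ^ m * d
        ≤ (u * u * d ^ 2) ^ m * d := by gcongr
      _ = u ^ (2 * m * m + 3 * m) := by rw [hd]; ring

/-- `μ = binom(m + 1 + d, d) ≤ (2d)^{m+1}` for `m + 1 ≤ d`. [folklore] -/
theorem choose_le_two_mul_pow {m d : ℕ} (h : m + 1 ≤ d) : (m + 1 + d).choose d ≤ (2 * d) ^ (m + 1) :=
  calc (m + 1 + d).choose d = (m + 1 + d).choose (m + 1) := by rw [← Nat.choose_symm_add]
    _ ≤ (m + 1 + d) ^ (m + 1) := Nat.choose_le_pow _ _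
    _ ≤ (2 * d) ^ (m + 1) := Nat.pow_le_pow_left (by omega) _

/-- The size of `1/ε`: with `u = Cs`, `2^{m+1} ≤ C`, `d = u^m`, `a = ds`, `μ ≤ (2d)^{m+1}`, `H ≤ 3^s`:
`4 H^{d(m+1)μ} μ! μ d ≤ 3^E` with `E = 2 + a(m+1)μ + μ² + μ + d ≤ (m + 5) u^{2m² + 3m + 2}`.
[folklore] -/
theorem numerics_eps {μ : ℕ} (hs : 1 ≤ s) (hC : 2 ^ (m + 1) ≤ C) (hd : d = (C * s) ^ m)
    (ha : a = d * s) (hμ : μ ≤ (2 * d) ^ (m + 1)) {H : ℕ} (hH : H ≤ 3 ^ s) :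
    4 * H ^ (d * (m + 1) * μ) * μ.factorial * μ * d ≤ 3 ^ (2 + a * (m + 1) * μ + μ * μ + μ + d) ∧
      2 + a * (m + 1) * μ + μ * μ + μ + d ≤ (m + 5) * (C * s) ^ (2 * m * m + 3 * m + 2) := by
  have h3 : ∀ k : ℕ, k ≤ 3 ^ k := fun k => (Nat.lt_pow_self (by norm_num)).le
  constructor
  · have p1 : H ^ (d * (m + 1) * μ) ≤ 3 ^ (a * (m + 1) * μ) :=
      calc H ^ (d * (m + 1) * μ) ≤ (3 ^ s) ^ (d * (m + 1) * μ) := Nat.pow_le_pow_left hH _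
        _ = 3 ^ (a * (m + 1) * μ) := by rw [← pow_mul, ha]; congr 1; ring
    have p2 : μ.factorial ≤ 3 ^ (μ * μ) :=
      calc μ.factorial ≤ μ ^ μ := Nat.factorial_le_pow μ
        _ ≤ (3 ^ μ) ^ μ := Nat.pow_le_pow_left (h3 μ) _
        _ = 3 ^ (μ * μ) := by rw [← pow_mul]
    calc 4 * H ^ (d * (m + 1) * μ) * μ.factorial * μ * d
        ≤ 3 ^ 2 * 3 ^ (a * (m + 1) * μ) * 3 ^ (μ * μ) * 3 ^ μ * 3 ^ d :=
          Nat.mul_le_mul (Nat.mul_le_mul (Nat.mul_le_mul (Nat.mul_le_mul (by norm_num) p1) p2)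
            (h3 μ)) (h3 d)
      _ = 3 ^ (2 + a * (m + 1) * μ + μ * μ + μ + d) := by simp only [← pow_add]
  · have hu : C ≤ C * s := Nat.le_mul_of_pos_right _ hs
    have hu2 : 2 ≤ C * s := le_trans (le_trans (Nat.le_self_pow (Nat.succ_ne_zero m) 2) hC) hu
    have hu1 : 1 ≤ C * s := by omega
    have hC1 : 0 < C := (pow_pos (by norm_num : 0 < 2) (m + 1)).trans_le hC
    have hμu : μ ≤ (C * s) ^ (m * m + m + 1) :=
      calc μ ≤ (2 * d) ^ (m + 1) := hμ
        _ = 2 ^ (m + 1) * d ^ (m + 1) := mul_pow _ _ _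
        _ ≤ (C * s) * (C * s) ^ (m * (m + 1)) := by
            rw [hd, ← pow_mul]
            exact Nat.mul_le_mul_right _ (hC.trans hu)
        _ = (C * s) ^ (m * m + m + 1) := by ring
    have hau : a ≤ (C * s) ^ (m + 1) := by
      rw [ha, hd, pow_succ]
      exact Nat.mul_le_mul_left _ (Nat.le_mul_of_pos_left s hC1)
    have hK : ∀ {k : ℕ}, k ≤ 2 * m * m + 3 * m + 2 → (C * s) ^ k ≤ (C * s) ^ (2 * m * m + 3 * m + 2) :=
      fun hk => Nat.pow_le_pow_right hu1 hk
    have t1 : a * (m + 1) * μ ≤ (m + 1) * (C * s) ^ (2 * m * m + 3 * m + 2) :=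
      calc a * (m + 1) * μ ≤ (C * s) ^ (m + 1) * (m + 1) * (C * s) ^ (m * m + m + 1) :=
            Nat.mul_le_mul (Nat.mul_le_mul_right _ hau) hμu
        _ = (m + 1) * (C * s) ^ (m * m + 2 * m + 2) := by ring
        _ ≤ (m + 1) * (C * s) ^ (2 * m * m + 3 * m + 2) := Nat.mul_le_mul_left _ (hK (by nlinarith))
    have t2 : μ * μ ≤ (C * s) ^ (2 * m * m + 3 * m + 2) :=
      calc μ * μ ≤ (C * s) ^ (m * m + m + 1) * (C * s) ^ (m * m + m + 1) := Nat.mul_le_mul hμu hμu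
        _ = (C * s) ^ (2 * m * m + 2 * m + 2) := by rw [← pow_add]; congr 1; ring
        _ ≤ (C * s) ^ (2 * m * m + 3 * m + 2) := hK (by nlinarith)
    have t3 : μ ≤ (C * s) ^ (2 * m * m + 3 * m + 2) := hμu.trans (hK (by nlinarith))
    have t4 : d ≤ (C * s) ^ (2 * m * m + 3 * m + 2) := by rw [hd]; exact hK (by nlinarith)
    have t5 : 2 ≤ (C * s) ^ (2 * m * m + 3 * m + 2) :=
      hu2.trans ((pow_one (C * s)).symm.le.trans (hK (by nlinarith)))
    calc 2 + a * (m + 1) * μ + μ * μ + μ + d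
        ≤ (C * s) ^ (2 * m * m + 3 * m + 2) + (m + 1) * (C * s) ^ (2 * m * m + 3 * m + 2) +
          (C * s) ^ (2 * m * m + 3 * m + 2) + (C * s) ^ (2 * m * m + 3 * m + 2) +
          (C * s) ^ (2 * m * m + 3 * m + 2) := by gcongr
      _ = (m + 5) * (C * s) ^ (2 * m * m + 3 * m + 2) := by ring

end Numerics

/-! ### Proposition 23 (`g = 1`) -/

section Prop23

/-- The case `m = 0` of `BinyaminiNovikovZak2024_prop23_rat`: `I^0` is a point, one linear
polynomial vanishes at its image. [folklore] -/
theorem BinyaminiNovikovZak2024_prop23_rat_zero :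
    ∃ (c : ℝ) (κ : ℕ), ∀ H : ℕ, 1 ≤ H → ∃ r D : ℕ,
      (r : ℝ) ≤ c * (Real.log H + 1) ^ κ ∧ (D : ℝ) ≤ c * (Real.log H + 1) ^ κ ∧
      ∀ φ : (Fin 0 → ℝ) → Fin (0 + 1) → ℝ,
        (∀ l, ContDiffOn ℝ r (fun x => φ x l) (Set.pi Set.univ fun _ : Fin 0 => Set.Ioo (0 : ℝ) 1)) →
        (∀ l, ∀ i ≤ r, ∀ x ∈ Set.pi Set.univ (fun _ : Fin 0 => Set.Ioo (0 : ℝ) 1),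
            ‖iteratedFDeriv ℝ i (fun x => φ x l) x‖ ≤ 1) →
        ∃ P : MvPolynomial (Fin (0 + 1)) ℝ, P ≠ 0 ∧ P.totalDegree ≤ D ∧
          ratPointsLE (φ '' Set.pi Set.univ (fun _ : Fin 0 => Set.Ioo (0 : ℝ) 1)) H ⊆
            {x | MvPolynomial.eval x P = 0} := by
  refine ⟨1, 0, fun H _ => ⟨0, 1, by norm_num, by norm_num, fun φ _ _ => ?_⟩⟩
  refine ⟨MvPolynomial.X 0 - MvPolynomial.C (φ default 0), fun h => ?_, ?_, ?_⟩
  · have := congrArg (MvPolynomial.eval fun _ => φ default 0 + 1) h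
    simp at this
  · calc (MvPolynomial.X (R := ℝ) (0 : Fin (0 + 1)) - MvPolynomial.C (φ default 0)).totalDegree
        ≤ max (MvPolynomial.X (R := ℝ) (0 : Fin (0 + 1))).totalDegree
            (MvPolynomial.C (σ := Fin (0 + 1)) (φ default 0)).totalDegree :=
          MvPolynomial.totalDegree_sub _ _
      _ = 1 := by rw [MvPolynomial.totalDegree_X, MvPolynomial.totalDegree_C]; rfl
  · intro x hx
    rw [mem_ratPointsLE_iff] at hx
    obtain ⟨⟨z, -, rfl⟩, -⟩ := hx
    obtain rfl : z = default := Subsingleton.elim _ _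
    simp

/-- The case `m ≥ 1` of `BinyaminiNovikovZak2024_prop23_rat`, with the explicit parameters of the
module docstring. [cite: BinyaminiNovikovZak2024, Prop. 23 (proof, `g = 1`)] -/
theorem BinyaminiNovikovZak2024_prop23_rat_pos {m : ℕ} (hm : 1 ≤ m) :
    ∃ (c : ℝ) (κ : ℕ), ∀ H : ℕ, 1 ≤ H → ∃ r D : ℕ,
      (r : ℝ) ≤ c * (Real.log H + 1) ^ κ ∧ (D : ℝ) ≤ c * (Real.log H + 1) ^ κ ∧
      ∀ φ : (Fin m → ℝ) → Fin (m + 1) → ℝ,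
        (∀ l, ContDiffOn ℝ r (fun x => φ x l) (Set.pi Set.univ fun _ : Fin m => Set.Ioo (0 : ℝ) 1)) →
        (∀ l, ∀ i ≤ r, ∀ x ∈ Set.pi Set.univ (fun _ : Fin m => Set.Ioo (0 : ℝ) 1),
            ‖iteratedFDeriv ℝ i (fun x => φ x l) x‖ ≤ 1) →
        ∃ P : MvPolynomial (Fin (m + 1)) ℝ, P ≠ 0 ∧ P.totalDegree ≤ D ∧
          ratPointsLE (φ '' Set.pi Set.univ (fun _ : Fin m => Set.Ioo (0 : ℝ) 1)) H ⊆
            {x | MvPolynomial.eval x P = 0} := by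
  -- the constants
  obtain ⟨C, hC⟩ : ∃ C : ℕ, C = 6 * (m + 1).factorial * (3 ^ (m + 2) * 2 ^ ((m + 1) * (m + 1))) :=
    ⟨_, rfl⟩
  have hfac : 1 ≤ (m + 1).factorial := Nat.factorial_pos _
  have hK : 1 ≤ 3 ^ (m + 2) * 2 ^ ((m + 1) * (m + 1)) := Nat.one_le_iff_ne_zero.mpr (by positivity)
  have hC6 : 6 * (m + 1).factorial ≤ C := hC ▸ Nat.le_mul_of_pos_right _ hK
  have hC3 : 3 ^ (m + 2) ≤ C := by
    rw [hC]
    calc 3 ^ (m + 2) ≤ 3 ^ (m + 2) * 2 ^ ((m + 1) * (m + 1)) := Nat.le_mul_of_pos_right _ (by positivity)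
      _ ≤ _ := Nat.le_mul_of_pos_left _ (by positivity)
  have hC4 : 2 ^ ((m + 1) * (m + 1)) ≤ C := by
    rw [hC]
    calc 2 ^ ((m + 1) * (m + 1)) ≤ 3 ^ (m + 2) * 2 ^ ((m + 1) * (m + 1)) :=
          Nat.le_mul_of_pos_left _ (by positivity)
      _ ≤ _ := Nat.le_mul_of_pos_left _ (by positivity)
  have hC2 : 2 ≤ C := le_trans (by omega) hC6
  refine ⟨(C : ℝ) ^ (2 * m * m + 3 * m), 2 * m * m + 3 * m, fun H hH => ?_⟩
  -- the parameters
  obtain ⟨s, hs⟩ : ∃ s : ℕ, s = Nat.log 3 H + 1 := ⟨_, rfl⟩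
  obtain ⟨d, hd⟩ : ∃ d : ℕ, d = (C * s) ^ m := ⟨_, rfl⟩
  obtain ⟨a, ha⟩ : ∃ a : ℕ, a = d * s := ⟨_, rfl⟩
  obtain ⟨T, hT⟩ : ∃ T : ℕ, T = 3 ^ (m + 2) * 2 ^ ((m + 1) * (m + 1)) * d ^ 2 := ⟨_, rfl⟩
  have hs1 : 1 ≤ s := by omega
  have hH3 : H ≤ 3 ^ s := hs ▸ (Nat.lt_pow_succ_log_self (by norm_num : 1 < 3) H).le
  have hu1 : 1 ≤ C * s := Nat.one_le_iff_ne_zero.mpr (by positivity)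
  have hd1 : 1 ≤ d := hd ▸ Nat.one_le_pow _ _ hu1
  have ha1 : 1 ≤ a := ha ▸ Nat.one_le_iff_ne_zero.mpr (by positivity)
  have hT1 : 1 ≤ T := hT ▸ Nat.one_le_iff_ne_zero.mpr (by positivity)
  obtain ⟨b, hb⟩ : ∃ b : ℕ, b + 1 = 2 * a := ⟨2 * a - 1, by omega⟩
  -- polylog bounds
  have hsl : (s : ℝ) ≤ Real.log H + 1 := hs ▸ natLog_three_add_one_le hH
  obtain ⟨hr, hD⟩ := numerics_polylog (s := s) hm (le_trans hC2 (Nat.le_mul_of_pos_right _ hs1))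
    (le_trans (Nat.le_mul_of_pos_left s (by omega)) le_rfl) (le_trans hC3 (Nat.le_mul_of_pos_right _ hs1))
    (le_trans hC4 (Nat.le_mul_of_pos_right _ hs1)) hd ha
  have hpoly : ((C * s) ^ (2 * m * m + 3 * m) : ℝ) ≤ (C : ℝ) ^ (2 * m * m + 3 * m) *
      (Real.log H + 1) ^ (2 * m * m + 3 * m) := by
    rw [← mul_pow]
    exact pow_le_pow_left₀ (by positivity) (mul_le_mul_of_nonneg_left hsl (by positivity)) _
  refine ⟨b + 1, T ^ m * d, ?_, ?_, fun φ hφ hφb => ?_⟩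
  · calc ((b + 1 : ℕ) : ℝ) ≤ ((C * s) ^ (2 * m * m + 3 * m) : ℕ) := by exact_mod_cast hb ▸ hr
      _ ≤ _ := by push_cast; exact hpoly
  · calc ((T ^ m * d : ℕ) : ℝ) ≤ ((C * s) ^ (2 * m * m + 3 * m) : ℕ) := by exact_mod_cast hT ▸ hD
      _ ≤ _ := by push_cast; exact hpoly
  -- the one-ball step on the grid
  have hφ' : ∀ l, ContDiffOn ℝ (b + 1) (fun x => φ x l)
      (Set.pi Set.univ fun _ : Fin m => Set.Ioo (0 : ℝ) 1) := fun l => by exact_mod_cast hφ l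
  have h2D := two_mul_partialDim_le_choose hm hs1 hC6 hd ha hb
  have hDμ : ∑ β ∈ Finset.range (b + 1), (m + β - 1).choose β ≤ (m + 1 + d).choose d := by omega
  have hμ1 : 1 ≤ (m + 1 + d).choose d := Nat.choose_pos (by omega)
  have haB := mul_le_exponentB (S := ∑ β ∈ Finset.range (b + 1), (m + β - 1).choose β * β) hb h2D
  have hprod := numerics_prod_le_pow hm hs1 hC6 hd ha hH3
  have hsmall := hsmall_of_natBounds (n := m + 1) (H := H) hμ1 ha1 hb haB hT1 (hT ▸ hprod)
  exact exists_mvPolynomial_of_image_unitCube φ hφ' hφb hd1 hT1 hDμ (hsmall.trans_lt (by norm_num))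

/-- **Binyamini–Novikov–Zak 2024, Proposition 23, for rational points (`g = 1`).** For every `m`
there are `c, κ` (depending only on `m`) such that for every `H ≥ 1` there are a smoothness order
`r ≤ c (log H + 1)^κ` and a degree `D ≤ c (log H + 1)^κ` with the following property: for every
chart `φ : I^m → ℝ^{m+1}` (`I = (0, 1)`) of class `C^r` on `I^m` with `‖D^i φ_l(x)‖ ≤ 1` for all
`i ≤ r`, `l`, `x ∈ I^m`, there is a polynomial `P ≠ 0` of degree `≤ D` in `m + 1` variables with
`(φ(I^m))(ℚ, H) ⊆ {P = 0}` — *"There are appropriate choices of `r, d = poly_m(g, log H)` … Let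
`φ : I^m → X` such that `φ(I^m) ⊆ X ⊂ I^{m+1}` and `‖φ‖_r ≤ 1`. Then there exists a polynomial
`P ∈ ℝ[x_1, …, x_{m+1}] ∖ {0}` of degree `d` such that `X(g, H) ⊂ {P = 0}`"*, proved as printed
for `g = 1` by the interpolation determinant method (height estimate
`det_monomial_eq_zero_or_one_le`, analytic estimate `abs_det_le_of_contDiffOn`, one ball
`exists_mvPolynomial_of_image_ball`, covering and product `exists_mvPolynomial_of_image_unitCube`,
parameters `numerics_prod_le_pow`/`numerics_polylog`).  Differences from the printed statement:
only the points of `φ(I^m)` (not of an `ε`-neighbourhood) and only `g = 1` are treated, and the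
`C^r` bound is imposed on the operator norms of the Fréchet derivatives (which dominate BNZ's
`‖φ‖_r`). [cite: BinyaminiNovikovZak2024, Prop. 23] [cite: Pila2022, Prop. 9.8]
[cite: BombieriPila1989] -/
theorem BinyaminiNovikovZak2024_prop23_rat (m : ℕ) :
    ∃ (c : ℝ) (κ : ℕ), ∀ H : ℕ, 1 ≤ H → ∃ r D : ℕ,
      (r : ℝ) ≤ c * (Real.log H + 1) ^ κ ∧ (D : ℝ) ≤ c * (Real.log H + 1) ^ κ ∧
      ∀ φ : (Fin m → ℝ) → Fin (m + 1) → ℝ,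
        (∀ l, ContDiffOn ℝ r (fun x => φ x l) (Set.pi Set.univ fun _ : Fin m => Set.Ioo (0 : ℝ) 1)) →
        (∀ l, ∀ i ≤ r, ∀ x ∈ Set.pi Set.univ (fun _ : Fin m => Set.Ioo (0 : ℝ) 1),
            ‖iteratedFDeriv ℝ i (fun x => φ x l) x‖ ≤ 1) →
        ∃ P : MvPolynomial (Fin (m + 1)) ℝ, P ≠ 0 ∧ P.totalDegree ≤ D ∧
          ratPointsLE (φ '' Set.pi Set.univ (fun _ : Fin m => Set.Ioo (0 : ℝ) 1)) H ⊆
            {x | MvPolynomial.eval x P = 0} := by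
  rcases Nat.eq_zero_or_pos m with rfl | hm
  · exact BinyaminiNovikovZak2024_prop23_rat_zero
  · exact BinyaminiNovikovZak2024_prop23_rat_pos hm

/-! ### Proposition 23 (`g = 1`) with the `ε`-neighbourhood -/

/-- Rational numbers with denominators `≤ H` are `1/H²`-separated. [folklore] -/
theorem rat_eq_of_abs_sub_lt_inv_sq {q q' : ℚ} {H : ℕ} (hq : q.den ≤ H) (hq' : q'.den ≤ H)
    (h : |(q : ℝ) - q'| < 1 / (H : ℝ) ^ 2) : q = q' := by
  by_contra hne
  have hk : q.num * q'.den - q'.num * q.den ≠ 0 := fun h0 =>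
    hne (Rat.eq_iff_mul_eq_mul.mpr (by linarith))
  have hden : (q.den : ℝ) ≠ 0 := by exact_mod_cast q.den_nz
  have hden' : (q'.den : ℝ) ≠ 0 := by exact_mod_cast q'.den_nz
  have hD : ((q.den * q'.den : ℕ) : ℝ) * ((q : ℝ) - q') =
      ((q.num * q'.den - q'.num * q.den : ℤ) : ℝ) := by
    push_cast
    rw [Rat.cast_def q, Rat.cast_def q']
    field_simp
  have h1 : (1 : ℝ) ≤ |((q.num * q'.den - q'.num * q.den : ℤ) : ℝ)| := by
    rw [← Int.cast_abs]; exact_mod_cast Int.one_le_abs hk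
  have hDpos : (0 : ℝ) < ((q.den * q'.den : ℕ) : ℝ) := by positivity
  have hH : ((q.den * q'.den : ℕ) : ℝ) ≤ (H : ℝ) ^ 2 := by
    rw [sq]; exact_mod_cast Nat.mul_le_mul hq hq'
  have hHpos : (0 : ℝ) < (H : ℝ) ^ 2 := hDpos.trans_le hH
  rw [← hD, abs_mul, abs_of_pos hDpos] at h1
  rw [lt_div_iff₀ hHpos] at h
  nlinarith [abs_nonneg ((q : ℝ) - q')]

/-- The case `m = 0` of `BinyaminiNovikovZak2024_prop23_rat_near`: `I^0` is a point `z`, and for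
`ε = 1/(4H²)` at most one point of `[0, 1](ℚ, H)` is within `ε` of `φ(z)`
(`rat_eq_of_abs_sub_lt_inv_sq`); a linear polynomial vanishes there. [folklore] -/
theorem BinyaminiNovikovZak2024_prop23_rat_near_zero :
    ∃ (c : ℝ) (κ : ℕ), ∀ H : ℕ, 1 ≤ H → ∃ (r D : ℕ) (ε : ℝ), 0 < ε ∧
      (r : ℝ) ≤ c * (Real.log H + 1) ^ κ ∧ (D : ℝ) ≤ c * (Real.log H + 1) ^ κ ∧
      -Real.log ε ≤ c * (Real.log H + 1) ^ κ ∧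
      ∀ φ : (Fin 0 → ℝ) → Fin (0 + 1) → ℝ,
        (∀ l, ContDiffOn ℝ r (fun x => φ x l) (Set.pi Set.univ fun _ : Fin 0 => Set.Ioo (0 : ℝ) 1)) →
        (∀ l, ∀ i ≤ r, ∀ x ∈ Set.pi Set.univ (fun _ : Fin 0 => Set.Ioo (0 : ℝ) 1),
            ‖iteratedFDeriv ℝ i (fun x => φ x l) x‖ ≤ 1) →
        Set.MapsTo φ (Set.pi Set.univ fun _ : Fin 0 => Set.Ioo (0 : ℝ) 1)
          (Set.pi Set.univ fun _ : Fin (0 + 1) => Set.Icc (0 : ℝ) 1) →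
        ∃ P : MvPolynomial (Fin (0 + 1)) ℝ, P ≠ 0 ∧ P.totalDegree ≤ D ∧
          ∀ x ∈ ratPointsLE (Set.pi Set.univ fun _ : Fin (0 + 1) => Set.Icc (0 : ℝ) 1) H,
            (∃ z ∈ Set.pi Set.univ (fun _ : Fin 0 => Set.Ioo (0 : ℝ) 1), ‖φ z - x‖ ≤ ε) →
              MvPolynomial.eval x P = 0 := by
  classical
  refine ⟨4, 1, fun H hH => ⟨0, 1, 1 / (4 * (H : ℝ) ^ 2), by positivity, ?_, ?_, ?_, fun φ _ _ _ => ?_⟩⟩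
  · push_cast; nlinarith [Real.log_nonneg (show (1 : ℝ) ≤ H by exact_mod_cast hH)]
  · push_cast; nlinarith [Real.log_nonneg (show (1 : ℝ) ≤ H by exact_mod_cast hH)]
  · have hH' : (0 : ℝ) < H := by exact_mod_cast hH
    have hlog4 : Real.log 4 ≤ 3 := by
      have := Real.log_le_sub_one_of_pos (show (0 : ℝ) < 4 by norm_num); linarith
    rw [one_div, Real.log_inv, neg_neg, Real.log_mul (by norm_num) (by positivity), Real.log_pow]
    push_cast
    nlinarith [Real.log_nonneg (show (1 : ℝ) ≤ H by exact_mod_cast hH)]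
  · have hdeg : ∀ c : ℝ, (MvPolynomial.X (R := ℝ) (0 : Fin (0 + 1)) - MvPolynomial.C c).totalDegree ≤ 1 :=
      fun c =>
      calc (MvPolynomial.X (R := ℝ) (0 : Fin (0 + 1)) - MvPolynomial.C c).totalDegree
          ≤ max (MvPolynomial.X (R := ℝ) (0 : Fin (0 + 1))).totalDegree
              (MvPolynomial.C (σ := Fin (0 + 1)) c).totalDegree := MvPolynomial.totalDegree_sub _ _
        _ = 1 := by rw [MvPolynomial.totalDegree_X, MvPolynomial.totalDegree_C]; rfl
    have hne : ∀ c : ℝ, MvPolynomial.X (R := ℝ) (0 : Fin (0 + 1)) - MvPolynomial.C c ≠ 0 := fun c h => by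
      have := congrArg (MvPolynomial.eval fun _ => c + 1) h
      simp at this
    by_cases hS : ∃ x₁ ∈ ratPointsLE (Set.pi Set.univ fun _ : Fin (0 + 1) => Set.Icc (0 : ℝ) 1) H,
        ∃ z ∈ Set.pi Set.univ (fun _ : Fin 0 => Set.Ioo (0 : ℝ) 1), ‖φ z - x₁‖ ≤ 1 / (4 * (H : ℝ) ^ 2)
    · obtain ⟨x₁, hx₁, z₁, -, hz₁⟩ := hS
      refine ⟨MvPolynomial.X 0 - MvPolynomial.C (x₁ 0), hne _, hdeg _, fun x hx ⟨z, _, hz⟩ => ?_⟩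
      obtain ⟨q, hqx, hqH⟩ := exists_rat_den_le_of_mem_ratPointsLE hx
      obtain ⟨q₁, hqx₁, hqH₁⟩ := exists_rat_den_le_of_mem_ratPointsLE hx₁
      have hzz : z = z₁ := Subsingleton.elim _ _
      subst hzz
      have hH' : (0 : ℝ) < H := by exact_mod_cast hH
      have h0 : |x 0 - x₁ 0| < 1 / (H : ℝ) ^ 2 := by
        have e1 : |φ z 0 - x 0| ≤ 1 / (4 * (H : ℝ) ^ 2) := by
          rw [← Real.norm_eq_abs]; exact (norm_le_pi_norm (φ z - x) 0).trans hz
        have e2 : |φ z 0 - x₁ 0| ≤ 1 / (4 * (H : ℝ) ^ 2) := by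
          rw [← Real.norm_eq_abs]; exact (norm_le_pi_norm (φ z - x₁) 0).trans hz₁
        calc |x 0 - x₁ 0| = |(φ z 0 - x₁ 0) - (φ z 0 - x 0)| := by ring_nf
          _ ≤ |φ z 0 - x₁ 0| + |φ z 0 - x 0| := abs_sub _ _
          _ ≤ 1 / (4 * (H : ℝ) ^ 2) + 1 / (4 * (H : ℝ) ^ 2) := add_le_add e2 e1
          _ = 1 / (2 * (H : ℝ) ^ 2) := by ring
          _ < 1 / (H : ℝ) ^ 2 := by
              rw [div_lt_div_iff_of_pos_left one_pos (by positivity) (by positivity)]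
              nlinarith [pow_pos hH' 2]
      have hq0 : q 0 = q₁ 0 := by
        refine rat_eq_of_abs_sub_lt_inv_sq (hqH 0) (hqH₁ 0) ?_
        have hx0 : ((q 0 : ℚ) : ℝ) = x 0 := congrFun hqx 0
        have hx1 : ((q₁ 0 : ℚ) : ℝ) = x₁ 0 := congrFun hqx₁ 0
        rwa [hx0, hx1]
      have hxx : x 0 = x₁ 0 := by
        rw [← congrFun hqx 0, ← congrFun hqx₁ 0]; exact_mod_cast congrArg (fun t : ℚ => (t : ℝ)) hq0
      simp [hxx]
    · refine ⟨MvPolynomial.X 0 - MvPolynomial.C 0, hne _, hdeg _, fun x hx hz => ?_⟩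
      exact absurd ⟨x, hx, hz⟩ hS

/-- The case `m ≥ 1` of `BinyaminiNovikovZak2024_prop23_rat_near`, with the explicit parameters of
the module docstring and `ε = 1/(4 H^{d(m+1)μ} μ! μ d)`.
[cite: BinyaminiNovikovZak2024, Prop. 23 (proof, `g = 1`)] -/
theorem BinyaminiNovikovZak2024_prop23_rat_near_pos {m : ℕ} (hm : 1 ≤ m) :
    ∃ (c : ℝ) (κ : ℕ), ∀ H : ℕ, 1 ≤ H → ∃ (r D : ℕ) (ε : ℝ), 0 < ε ∧
      (r : ℝ) ≤ c * (Real.log H + 1) ^ κ ∧ (D : ℝ) ≤ c * (Real.log H + 1) ^ κ ∧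
      -Real.log ε ≤ c * (Real.log H + 1) ^ κ ∧
      ∀ φ : (Fin m → ℝ) → Fin (m + 1) → ℝ,
        (∀ l, ContDiffOn ℝ r (fun x => φ x l) (Set.pi Set.univ fun _ : Fin m => Set.Ioo (0 : ℝ) 1)) →
        (∀ l, ∀ i ≤ r, ∀ x ∈ Set.pi Set.univ (fun _ : Fin m => Set.Ioo (0 : ℝ) 1),
            ‖iteratedFDeriv ℝ i (fun x => φ x l) x‖ ≤ 1) →
        Set.MapsTo φ (Set.pi Set.univ fun _ : Fin m => Set.Ioo (0 : ℝ) 1)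
          (Set.pi Set.univ fun _ : Fin (m + 1) => Set.Icc (0 : ℝ) 1) →
        ∃ P : MvPolynomial (Fin (m + 1)) ℝ, P ≠ 0 ∧ P.totalDegree ≤ D ∧
          ∀ x ∈ ratPointsLE (Set.pi Set.univ fun _ : Fin (m + 1) => Set.Icc (0 : ℝ) 1) H,
            (∃ z ∈ Set.pi Set.univ (fun _ : Fin m => Set.Ioo (0 : ℝ) 1), ‖φ z - x‖ ≤ ε) →
              MvPolynomial.eval x P = 0 := by
  -- the constants
  obtain ⟨C, hC⟩ : ∃ C : ℕ, C = 6 * (m + 1).factorial * (3 ^ (m + 2) * 2 ^ ((m + 1) * (m + 1))) :=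
    ⟨_, rfl⟩
  have hfac : 1 ≤ (m + 1).factorial := Nat.factorial_pos _
  have hK : 1 ≤ 3 ^ (m + 2) * 2 ^ ((m + 1) * (m + 1)) := Nat.one_le_iff_ne_zero.mpr (by positivity)
  have hC6 : 6 * (m + 1).factorial ≤ C := hC ▸ Nat.le_mul_of_pos_right _ hK
  have hC3 : 3 ^ (m + 2) ≤ C := by
    rw [hC]
    calc 3 ^ (m + 2) ≤ 3 ^ (m + 2) * 2 ^ ((m + 1) * (m + 1)) := Nat.le_mul_of_pos_right _ (by positivity)
      _ ≤ _ := Nat.le_mul_of_pos_left _ (by positivity)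
  have hC4 : 2 ^ ((m + 1) * (m + 1)) ≤ C := by
    rw [hC]
    calc 2 ^ ((m + 1) * (m + 1)) ≤ 3 ^ (m + 2) * 2 ^ ((m + 1) * (m + 1)) :=
          Nat.le_mul_of_pos_left _ (by positivity)
      _ ≤ _ := Nat.le_mul_of_pos_left _ (by positivity)
  have hC5 : 2 ^ (m + 1) ≤ C := le_trans (Nat.pow_le_pow_right (by norm_num) (by nlinarith)) hC4
  have hC2 : 2 ≤ C := le_trans (by omega) hC6
  set K : ℕ := 2 * m * m + 3 * m + 2 with hKdef
  refine ⟨2 * ((m : ℝ) + 5) * (C : ℝ) ^ K, K, fun H hH => ?_⟩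
  -- the parameters
  obtain ⟨s, hs⟩ : ∃ s : ℕ, s = Nat.log 3 H + 1 := ⟨_, rfl⟩
  obtain ⟨d, hd⟩ : ∃ d : ℕ, d = (C * s) ^ m := ⟨_, rfl⟩
  obtain ⟨a, ha⟩ : ∃ a : ℕ, a = d * s := ⟨_, rfl⟩
  obtain ⟨T, hT⟩ : ∃ T : ℕ, T = 3 ^ (m + 2) * 2 ^ ((m + 1) * (m + 1)) * d ^ 2 := ⟨_, rfl⟩
  have hs1 : 1 ≤ s := by omega
  have hH3 : H ≤ 3 ^ s := hs ▸ (Nat.lt_pow_succ_log_self (by norm_num : 1 < 3) H).le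
  have hu1 : 1 ≤ C * s := Nat.one_le_iff_ne_zero.mpr (by positivity)
  have hd1 : 1 ≤ d := hd ▸ Nat.one_le_pow _ _ hu1
  have ha1 : 1 ≤ a := ha ▸ Nat.one_le_iff_ne_zero.mpr (by positivity)
  have hT1 : 1 ≤ T := hT ▸ Nat.one_le_iff_ne_zero.mpr (by positivity)
  obtain ⟨b, hb⟩ : ∃ b : ℕ, b + 1 = 2 * a := ⟨2 * a - 1, by omega⟩
  have hC1 : m + 1 ≤ C :=
    le_trans (le_trans (Nat.self_le_factorial (m + 1)) (Nat.le_mul_of_pos_left _ (by norm_num))) hC6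
  have hmd : m + 1 ≤ d := le_trans (le_trans hC1 (Nat.le_mul_of_pos_right _ hs1))
    (hd ▸ Nat.le_self_pow (by omega) _)
  have hμ1 : 1 ≤ (m + 1 + d).choose d := Nat.choose_pos (by omega)
  have hH0 : (0 : ℝ) < H := by exact_mod_cast hH
  -- polylog bounds
  have hsl : (s : ℝ) ≤ Real.log H + 1 := hs ▸ natLog_three_add_one_le hH
  obtain ⟨hr, hD⟩ := numerics_polylog (s := s) hm (le_trans hC2 (Nat.le_mul_of_pos_right _ hs1))
    (le_trans (Nat.le_mul_of_pos_left s (by omega)) le_rfl) (le_trans hC3 (Nat.le_mul_of_pos_right _ hs1))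
    (le_trans hC4 (Nat.le_mul_of_pos_right _ hs1)) hd ha
  obtain ⟨hQ, hE⟩ := numerics_eps (μ := (m + 1 + d).choose d) hs1 hC5 hd ha
    (choose_le_two_mul_pow hmd) hH3
  have hpoly : ((C * s) ^ K : ℝ) ≤ (C : ℝ) ^ K * (Real.log H + 1) ^ K := by
    rw [← mul_pow]
    exact pow_le_pow_left₀ (by positivity) (mul_le_mul_of_nonneg_left hsl (by positivity)) _
  have hc1 : (C : ℝ) ^ K * (Real.log H + 1) ^ K ≤ 2 * ((m : ℝ) + 5) * (C : ℝ) ^ K * (Real.log H + 1) ^ K := by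
    have h0 : (0 : ℝ) ≤ (C : ℝ) ^ K * (Real.log H + 1) ^ K := by
      have := Real.log_nonneg (show (1 : ℝ) ≤ H by exact_mod_cast hH); positivity
    nlinarith
  have hK0 : 2 * m * m + 3 * m ≤ K := by omega
  -- ε
  set X : ℝ := (H : ℝ) ^ (d * (m + 1) * (m + 1 + d).choose d) *
    ((((m + 1 + d).choose d).factorial : ℕ) * (((m + 1 + d).choose d : ℕ) * (d : ℝ))) with hX
  have hX0 : 0 < X := by positivity
  have hX4 : 4 * X = ((4 * H ^ (d * (m + 1) * (m + 1 + d).choose d) *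
      ((m + 1 + d).choose d).factorial * (m + 1 + d).choose d * d : ℕ) : ℝ) := by
    rw [hX]; push_cast; ring
  refine ⟨b + 1, T ^ m * d, 1 / (4 * X), by positivity, ?_, ?_, ?_, fun φ hφ hφb hφI => ?_⟩
  · calc ((b + 1 : ℕ) : ℝ) ≤ ((C * s) ^ K : ℕ) := by
          exact_mod_cast hb ▸ hr.trans (Nat.pow_le_pow_right hu1 hK0)
      _ ≤ _ := by push_cast; exact hpoly.trans hc1
  · calc ((T ^ m * d : ℕ) : ℝ) ≤ ((C * s) ^ K : ℕ) := by
          exact_mod_cast hT ▸ hD.trans (Nat.pow_le_pow_right hu1 hK0)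
      _ ≤ _ := by push_cast; exact hpoly.trans hc1
  · have hlog3 : Real.log 3 ≤ 2 := by
      rw [Real.log_le_iff_le_exp (by norm_num)]
      have := Real.add_one_le_exp (2 : ℝ)
      linarith
    rw [one_div, Real.log_inv, neg_neg, hX4]
    calc Real.log ((4 * H ^ (d * (m + 1) * (m + 1 + d).choose d) *
          ((m + 1 + d).choose d).factorial * (m + 1 + d).choose d * d : ℕ) : ℝ)
        ≤ Real.log ((3 ^ (2 + a * (m + 1) * (m + 1 + d).choose d +
            (m + 1 + d).choose d * (m + 1 + d).choose d + (m + 1 + d).choose d + d) : ℕ) : ℝ) := by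
          apply Real.log_le_log (by rw [← hX4]; positivity)
          exact_mod_cast hQ
      _ = (2 + a * (m + 1) * (m + 1 + d).choose d +
            (m + 1 + d).choose d * (m + 1 + d).choose d + (m + 1 + d).choose d + d : ℕ) *
            Real.log 3 := by
          push_cast
          rw [Real.log_pow]
          push_cast
          ring
      _ ≤ ((m + 5) * (C * s) ^ K : ℕ) * 2 :=
          mul_le_mul (by exact_mod_cast hE) hlog3 (Real.log_nonneg (by norm_num)) (by positivity)
      _ = 2 * ((m : ℝ) + 5) * ((C * s) ^ K : ℝ) := by push_cast; ring
      _ ≤ 2 * ((m : ℝ) + 5) * ((C : ℝ) ^ K * (Real.log H + 1) ^ K) :=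
          mul_le_mul_of_nonneg_left hpoly (by positivity)
      _ = 2 * ((m : ℝ) + 5) * (C : ℝ) ^ K * (Real.log H + 1) ^ K := by ring
  -- the one-ball step on the grid, with the perturbation
  have hφ' : ∀ l, ContDiffOn ℝ (b + 1) (fun x => φ x l)
      (Set.pi Set.univ fun _ : Fin m => Set.Ioo (0 : ℝ) 1) := fun l => by exact_mod_cast hφ l
  have h2D := two_mul_partialDim_le_choose hm hs1 hC6 hd ha hb
  have hDμ : ∑ β ∈ Finset.range (b + 1), (m + β - 1).choose β ≤ (m + 1 + d).choose d := by omega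
  have haB := mul_le_exponentB (S := ∑ β ∈ Finset.range (b + 1), (m + β - 1).choose β * β) hb h2D
  have hprod := numerics_prod_le_pow hm hs1 hC6 hd ha hH3
  have hsmall := hsmall_of_natBounds (n := m + 1) (H := H) hμ1 ha1 hb haB hT1 (hT ▸ hprod)
  have hε : (H : ℝ) ^ (d * (m + 1) * (m + 1 + d).choose d) *
      ((((m + 1 + d).choose d).factorial : ℕ) * (((m + 1 + d).choose d : ℕ) * ((d : ℝ) * (1 / (4 * X))))) <
      1 / 2 := by
    have : (H : ℝ) ^ (d * (m + 1) * (m + 1 + d).choose d) *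
        ((((m + 1 + d).choose d).factorial : ℕ) * (((m + 1 + d).choose d : ℕ) * ((d : ℝ) * (1 / (4 * X))))) =
        X * (1 / (4 * X)) := by rw [hX]; ring
    have h4 : X * (1 / (4 * X)) = 1 / 4 := by
      field_simp
    rw [this, h4]
    norm_num
  exact exists_mvPolynomial_of_near_image_unitCube φ hφ' hφb hφI hd1 hT1 hDμ (by positivity) hsmall hε

/-- **Binyamini–Novikov–Zak 2024, Proposition 23 (`g = 1`), with the `ε`-neighbourhood.** For
every `m` there are `c, κ` such that for every `H ≥ 1` there are `r, D ≤ c (log H + 1)^κ` and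
`ε > 0` with `log(1/ε) ≤ c (log H + 1)^κ` such that for every chart `φ : I^m → [0, 1]^{m+1}` of
class `C^r` with `‖D^i φ_l(x)‖ ≤ 1` (`i ≤ r`), there is a polynomial `P ≠ 0` of degree `≤ D` with
`X(ℚ, H) ∩ U_ε(φ(I^m)) ⊆ {P = 0}` for every `X ⊆ [0, 1]^{m+1}` — the statement as printed for
`g = 1` (*"There are appropriate choices of `r, d = poly_m(g, log H)` and
`log ε = −poly_m(g, log H)` such that the following holds. Let `φ : I^m → X` such that
`φ(I^m) ⊆ X ⊂ I^{m+1}` and `‖φ‖_r ≤ 1`. Then there exists a polynomial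
`P ∈ ℝ[x_1, …, x_{m+1}] ∖ {0}` of degree `d` such that `X(g, H) ⊂ {P = 0}`"*, where in the proof
`X(g, H)` is read inside `U_ε(φ(J^m))`), up to the normalisation of the `C^r` norm by operator
norms of Fréchet derivatives. [cite: BinyaminiNovikovZak2024, Prop. 23] -/
theorem BinyaminiNovikovZak2024_prop23_rat_near (m : ℕ) :
    ∃ (c : ℝ) (κ : ℕ), ∀ H : ℕ, 1 ≤ H → ∃ (r D : ℕ) (ε : ℝ), 0 < ε ∧
      (r : ℝ) ≤ c * (Real.log H + 1) ^ κ ∧ (D : ℝ) ≤ c * (Real.log H + 1) ^ κ ∧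
      -Real.log ε ≤ c * (Real.log H + 1) ^ κ ∧
      ∀ φ : (Fin m → ℝ) → Fin (m + 1) → ℝ,
        (∀ l, ContDiffOn ℝ r (fun x => φ x l) (Set.pi Set.univ fun _ : Fin m => Set.Ioo (0 : ℝ) 1)) →
        (∀ l, ∀ i ≤ r, ∀ x ∈ Set.pi Set.univ (fun _ : Fin m => Set.Ioo (0 : ℝ) 1),
            ‖iteratedFDeriv ℝ i (fun x => φ x l) x‖ ≤ 1) →
        Set.MapsTo φ (Set.pi Set.univ fun _ : Fin m => Set.Ioo (0 : ℝ) 1)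
          (Set.pi Set.univ fun _ : Fin (m + 1) => Set.Icc (0 : ℝ) 1) →
        ∃ P : MvPolynomial (Fin (m + 1)) ℝ, P ≠ 0 ∧ P.totalDegree ≤ D ∧
          ∀ x ∈ ratPointsLE (Set.pi Set.univ fun _ : Fin (m + 1) => Set.Icc (0 : ℝ) 1) H,
            (∃ z ∈ Set.pi Set.univ (fun _ : Fin m => Set.Ioo (0 : ℝ) 1), ‖φ z - x‖ ≤ ε) →
              MvPolynomial.eval x P = 0 := by
  rcases Nat.eq_zero_or_pos m with rfl | hm
  · exact BinyaminiNovikovZak2024_prop23_rat_near_zero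
  · exact BinyaminiNovikovZak2024_prop23_rat_near_pos hm

/-! ### Charts into `ℝⁿ`, `n > m + 1`: one hypersurface for each coordinate projection -/

/-- **Prop. 23 for a chart `φ : I^m → [0, 1]ⁿ` and each set `J` of `m + 1` coordinates** (BNZ
2024, proof of Theorem 1 (`thm:main-blocks`): *"Using Proposition 23 we can find for each
`J ⊂ {1, …, n}` of size `m + 1` a polynomial `P_J` of degree `d = poly_n(g, log H)` in the
coordinates `(x_i : i ∈ J)` vanishing on `X(g, H)`"*): with `c, κ, r, D, ε` as in
`BinyaminiNovikovZak2024_prop23_rat_near` (depending on `m` and `H` only), for every injective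
`J : [m+1] → [n]` there is `P = P₀(x_J) ≠ 0` of degree `≤ D` vanishing at all points of
`[0, 1]ⁿ(ℚ, H)` within `ε` of `φ(I^m)` (apply Prop. 23 to the chart `π_J ∘ φ`).
[cite: BinyaminiNovikovZak2024, Prop. 23 and proof of Thm. 1] -/
theorem BinyaminiNovikovZak2024_prop23_rat_near_proj (m n : ℕ) :
    ∃ (c : ℝ) (κ : ℕ), ∀ H : ℕ, 1 ≤ H → ∃ (r D : ℕ) (ε : ℝ), 0 < ε ∧
      (r : ℝ) ≤ c * (Real.log H + 1) ^ κ ∧ (D : ℝ) ≤ c * (Real.log H + 1) ^ κ ∧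
      -Real.log ε ≤ c * (Real.log H + 1) ^ κ ∧
      ∀ φ : (Fin m → ℝ) → Fin n → ℝ,
        (∀ l, ContDiffOn ℝ r (fun x => φ x l) (Set.pi Set.univ fun _ : Fin m => Set.Ioo (0 : ℝ) 1)) →
        (∀ l, ∀ i ≤ r, ∀ x ∈ Set.pi Set.univ (fun _ : Fin m => Set.Ioo (0 : ℝ) 1),
            ‖iteratedFDeriv ℝ i (fun x => φ x l) x‖ ≤ 1) →
        Set.MapsTo φ (Set.pi Set.univ fun _ : Fin m => Set.Ioo (0 : ℝ) 1)
          (Set.pi Set.univ fun _ : Fin n => Set.Icc (0 : ℝ) 1) →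
        ∀ J : Fin (m + 1) → Fin n, Function.Injective J →
          ∃ P : MvPolynomial (Fin n) ℝ, P ≠ 0 ∧ P.totalDegree ≤ D ∧
            (∃ P₀ : MvPolynomial (Fin (m + 1)) ℝ, P = MvPolynomial.rename J P₀) ∧
            ∀ x ∈ ratPointsLE (Set.pi Set.univ fun _ : Fin n => Set.Icc (0 : ℝ) 1) H,
              (∃ z ∈ Set.pi Set.univ (fun _ : Fin m => Set.Ioo (0 : ℝ) 1), ‖φ z - x‖ ≤ ε) →
                MvPolynomial.eval x P = 0 := by
  obtain ⟨c, κ, h⟩ := BinyaminiNovikovZak2024_prop23_rat_near m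
  refine ⟨c, κ, fun H hH => ?_⟩
  obtain ⟨r, D, ε, hε, hr, hD, hlε, hall⟩ := h H hH
  refine ⟨r, D, ε, hε, hr, hD, hlε, fun φ hφ hφb hφI J hJ => ?_⟩
  obtain ⟨P₀, hP0, hPd, hPZ⟩ := hall (fun z i => φ z (J i)) (fun i => hφ (J i))
    (fun i => hφb (J i)) fun z hz i _ => hφI hz (J i) (Set.mem_univ _)
  refine ⟨MvPolynomial.rename J P₀, fun h0 => hP0 (MvPolynomial.rename_injective J hJ (by simpa using h0)),
    (MvPolynomial.totalDegree_rename_le J P₀).trans hPd, ⟨P₀, rfl⟩, fun x hx ⟨z, hz, hzx⟩ => ?_⟩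
  rw [MvPolynomial.eval_rename]
  refine hPZ (x ∘ J) ?_ ⟨z, hz, ?_⟩
  · rw [mem_ratPointsLE_iff] at hx ⊢
    exact ⟨fun i _ => hx.1 (J i) (Set.mem_univ _), fun i => hx.2 (J i)⟩
  · rw [pi_norm_le_iff_of_nonneg hε.le]
    exact fun i => (norm_le_pi_norm (φ z - x) (J i)).trans hzx

/-- The same for points *on* the chart (no boundedness of `φ` needed):
`BinyaminiNovikovZak2024_prop23_rat` for `π_J ∘ φ`. [cite: BinyaminiNovikovZak2024, Prop. 23] -/
theorem BinyaminiNovikovZak2024_prop23_rat_proj (m n : ℕ) :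
    ∃ (c : ℝ) (κ : ℕ), ∀ H : ℕ, 1 ≤ H → ∃ r D : ℕ,
      (r : ℝ) ≤ c * (Real.log H + 1) ^ κ ∧ (D : ℝ) ≤ c * (Real.log H + 1) ^ κ ∧
      ∀ φ : (Fin m → ℝ) → Fin n → ℝ,
        (∀ l, ContDiffOn ℝ r (fun x => φ x l) (Set.pi Set.univ fun _ : Fin m => Set.Ioo (0 : ℝ) 1)) →
        (∀ l, ∀ i ≤ r, ∀ x ∈ Set.pi Set.univ (fun _ : Fin m => Set.Ioo (0 : ℝ) 1),
            ‖iteratedFDeriv ℝ i (fun x => φ x l) x‖ ≤ 1) →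
        ∀ J : Fin (m + 1) → Fin n, Function.Injective J →
          ∃ P : MvPolynomial (Fin n) ℝ, P ≠ 0 ∧ P.totalDegree ≤ D ∧
            (∃ P₀ : MvPolynomial (Fin (m + 1)) ℝ, P = MvPolynomial.rename J P₀) ∧
            ratPointsLE (φ '' Set.pi Set.univ (fun _ : Fin m => Set.Ioo (0 : ℝ) 1)) H ⊆
              {x | MvPolynomial.eval x P = 0} := by
  obtain ⟨c, κ, h⟩ := BinyaminiNovikovZak2024_prop23_rat m
  refine ⟨c, κ, fun H hH => ?_⟩
  obtain ⟨r, D, hr, hD, hall⟩ := h H hH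
  refine ⟨r, D, hr, hD, fun φ hφ hφb J hJ => ?_⟩
  obtain ⟨P₀, hP0, hPd, hPZ⟩ := hall (fun z i => φ z (J i)) (fun i => hφ (J i)) fun i => hφb (J i)
  refine ⟨MvPolynomial.rename J P₀, fun h0 => hP0 (MvPolynomial.rename_injective J hJ (by simpa using h0)),
    (MvPolynomial.totalDegree_rename_le J P₀).trans hPd, ⟨P₀, rfl⟩, fun x hx => ?_⟩
  rw [Set.mem_setOf_eq, MvPolynomial.eval_rename]
  refine hPZ ?_
  rw [mem_ratPointsLE_iff] at hx ⊢
  obtain ⟨⟨z, hz, rfl⟩, hq⟩ := hx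
  exact ⟨⟨z, hz, rfl⟩, fun i => hq (J i)⟩

end Prop23

end Literature.ModelTheory.ExponentialFields

end
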